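import Literature.MathematicalPhysics.QuantumFieldTheory.Balaban1983to89.B3DeltaGkKernelRegularNested
import Literature.MathematicalPhysics.QuantumFieldTheory.Balaban1983to89.B3DeltaGkMixedRegularRegion
import Literature.MathematicalPhysics.QuantumFieldTheory.Balaban1983to89.B3DeltaGkHolderRegularNested
import Literature.MathematicalPhysics.QuantumFieldTheory.Balaban1983to89.B3Ineq31RegularRegion

/-!
# Bałaban, *(Higgs)₂,₃ quantum fields in a finite volume III. Renormalization* [B3] — inequality (2.5) p. 424, the `δG_k(Ω,Ω₂,B̃)`
# alternative, `‖hδG_k(Ω,Ω₂,B̃)h′‖_{1,α} ≤ O(e^{−δ₀dist(Ω₂,∂Ω)})·e^{−δ₀dist(supp h, supp h′)}`, AT A REGULAR NON-CONSTANT BACKGROUND `B̃ = A`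
# FOR NESTED BIG-BLOCK REGIONS `Ω₂ ⊆ Ω ⊂ T_η` (every `L ≥ 2`), PROVED for a concrete carrier of `B3Sect2StatementsPart2.ScaledKernels`
# (the decl of record `ScaledKernels.Ineq25 α δ₀ C` of row B3.Eq2.5, per `0 ≤ α < 1`)

statement-level skeleton of published theorems with citation tags; proofs where landed; nothing here is a claim about the Yang–Mills mass gap

T. Bałaban, Commun. Math. Phys. **88** (1983) 411–445 [cite: Balaban1983Higgs3]; inputs from part I, Commun. Math. Phys. **85** (1982)
603–626 [cite: Balaban1982Higgs1] as landed in the tree.  PDF held: `paper:balaban1983-higgs-2-3-quantum-fields-finite-volume` (journal page =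
PDF page + 410), p. 414 [PDF 4], p. 420 [PDF 10] (`p0010.txt`), p. 424 [PDF 14] (`p0014.txt`), p. 426 [PDF 16].

CITATION HEADER (lean-in-tree rule).  Cell `lit-balaban` (HOME `run/shared/lean/pub/lit-balaban/`), Phase-2 proof seat **p33** gen 60 (unit
`lit-balaban-p33`; TAKING line HOME/STATUS.md 2026-08-22T23:47Z); SKELETON row **B3.Eq2.5** (fold owner r15; decl of record
`B3Sect2StatementsPart2.ScaledKernels.Ineq25`; owner division of labour HOME/STATUS 2026-08-22T22:50:53Z / 23:28:19Z, item (iv) «the Hölder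
entries + the (1.32) `Ineq25` assembly of hδG_kh′»).  The REGULAR-BACKGROUND NESTED-REGION MEMBER of the row, after p03's model instances at
`A = 0` (`B3Ineq25ZeroNest` nested boxes, `B3Ineq25ZeroLattice` lattice pair) and at a constant `B̃₀` (`B3Ineq25ConstNest`).  THE KERNEL ENTRIES,
USED BY NAME and never restated: the VALUE and ROW-DERIVATIVE kernels of `δG_k(Ω,Ω₂,A)` at scale `k` (r14 g18 `B3DeltaGkKernelRegularNested.
dG_kernel_bound_explicit` / `dG_kernel_deriv_bound_explicit`, p345219, summing r14's FILE 1 `B3DeltaPiecesRegularNested` over the pieces (2.6));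
the MIXED (twice-differentiated) entry piece by piece (p33 g58 `B3DeltaGkMixedRegularRegion.deltaGk_mixed_regularRegion`, p344322) and the HÖLDER
entry piece by piece (p33 g60 `B3DeltaGkHolderRegularNested.dPiece_holder_bound_explicit`, p345432), both summed over the scales here with r14's
`piece_sum_le`; THE (1.32) VOCABULARY of p40 g68/g69's `B3Ineq31RegularTorus`/`B3Ineq31RegularRegion` (row B3.Eq3.1): the product lattice
`PSite`/`PBd`/`hb`/`dirOf`/`baseOf`/`pdist`/`sites`/`bonds`/`bonds_spec`, the units `unitV`/`unitD`, the transports `transp` along the coordinatewise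
contours `cpath`, the cube geometry `cubeDist`/`sep_of_cubes`/`tdist_le_of_same_cube`/`blockIter_eq_of_mem_cpath`, the printed SUM form
`B3Sect1Statements.norm132`; r14 g17's region machinery `Interior`/`regRegionKernels`/`IsBigBlockUnion` and `distC`; p35's chain transport `hol` and path
lemma `norm_hol_apply_sub_le`; p40/p33's dipole source `dip`/`onb`.

## What is printed (verbatim)

(2.5) p. 424 [PDF 14]: *"In the estimates we treat them as external fields and we use the inequalities:
‖h(an operator δG_k(Ω,Ω₂,B̃) or (1.16))h′‖_{1,α} ≤ O(e^{−δ₀dist(Ω₂,∂Ω)} or (e(L^kε)p(L^kε))^{n+n′})e^{−δ₀dist(supp h, supp h′)}, (2.5) where h, h′ are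
functions giving the localizations of the vertices."*; p. 414 [PDF 4]: *"… so we will have also the propagators δG_k(Ω,Ω₂,B̃) = G_k(Ω,B̃) −
G_k(Ω₂,B̃). … This estimate follows easily from the properties of the propagators G_k(Ω,A) proved in the next paper."*; (1.32) p. 420 [PDF 10]:
*"‖f‖_{1,α} = sup_x|f(x)| + sup_{x,μ}|(D^η_{B̃,μ}f)(x)| + sup_{x,x′,μ}|x − x′|^{−α}|U(B̃(Γ_{x,x′}))(D^η_{B̃,μ}f)(x′) − (D^η_{B̃,μ}f)(x)|, (1.32) where
Γ_{x,x′} is a shortest contour connecting x and x′. This definition extends in a natural way to functions of many variables."*; p. 420: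
*"we localize simply by representing Ω₁ as a sum of unit cubes"*.

## What this file proves, and how

THE OBJECT.  `δG_k(Ω,Ω₂,A) = G^ε_k(Ω,A) − G^ε_k(Ω₂,A)` (r14's `B3DeltaPiecesRegularNested.dG … k`) for NESTED regions `Ω₂ ⊆ Ω ⊂ T_ε` that are
unions of big blocks (`IsBigBlockUnion k K₀`), at a background `A` that is `δ_A`-regular ON `Ω` in the sense (I.2.23).  The two-variable field
`F(x,x′) = δG_k(Ω,Ω₂,A;x,x′) ∈ Hom(ℝ^N_{x′}, ℝ^N_x)` on `□(v) × □(v′)` and its norm (1.32) are read EXACTLY as in p40's (3.1) files (§2: values = `N×N`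
blocks with the operator norm in the print's units `unitV = (L^kε)^{d−2}ε^{−d}`, covariant derivatives along the `2d` directions of the product lattice
with unit `unitD = (L^kε)^{d−1}ε^{−d}`, Hölder quotients over all same-direction bond pairs at positive sup-distance `|z − z′|/L^k`, transports
`U(A(Γ))∘·∘U(A(Γ′))^*` along `cpath` in both variables, the printed SUM `norm132`) — i.e. the SHARP UNIT CUBES `□(v)` of p. 420 as localization
functions, the same `kerF`/`derivF` shapes as `B3Ineq31RegularRegion` with `G_k(Ω,A)` replaced by `δG_k(Ω,Ω₂,A)`, so that p40's smooth-localization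
multiplier (`B3Ineq31SmoothLocalization`, row B3.Eq3.1 Q6) applies verbatim to this field.  THE CUBES: `LocCube k K₀ Ω₂ r₀` = the unit cubes all of
whose points are INTERIOR points of `Ω₂` (r14's `Interior k K₀ Ω₂`: Prop. I.2.1's `R₀`-clause, the hypothesis of every kernel entry) at lattice
distance `≥ r₀L^k` (i.e. `≥ r₀` in the `η`-units, `η = L^{−k}`) from `Ω₂ᶜ`; the carrier takes `distΩ₂ := r₀` — the reading of print's
`dist(Ω₂,∂Ω)` as the distance OF THE LOCALIZATIONS to the region where the two operators differ, which is what the cited source controls ([B1]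
(2.26), [B4] (1.12)); p03's reading, GAPS G-B3-14) — and `distSupp h h′ := dist(□(v),□(v′))` (`cubeDist`).

THE THEOREMS.  (a) **`ineq25_of_bounds`** (§4, an IMPLICATION): the four kernel entries of `δG_k(Ω,Ω₂,A)` at scale `k` in the model's units at
interior points — value, row derivative, transported Hölder difference (with the weight `(ε|x₁−x₂|)^α(L^kε)^{−α}`), mixed second derivative — each
with a decay factor `e^{−δ|·|/L^k}` and a boundary factor `e^{−δ·margin/L^k}`, give the first conjunct of `(sect2DeltaRegNested …).Ineq25 α δ
(C_V + C_D + C_H + dC_M)` for ALL pairs of admissible cubes, coincident and adjacent ones included (`δG_k` is regular on the diagonal); the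
(1.16) conjunct holds trivially for the carrier (not modelled, see below).  (b) **`dG_holder_bound_explicit`**, **`dG_mixed_bound_explicit`** (§5):
the Hölder and mixed entries AT SCALE `k`, summed over the pieces `j < k` (the doubly-exponential decay of the boundary factor of the low pieces at
interior points pays for the ratio of scales — r14's `piece_sum_le`, as for r14's value/derivative sums).  (c) **`ineq25_regularNested`** (§6,
HYPOTHESIS-FREE in the tree's sense): for `d ≥ 1`, `L ≥ 2`, `a, m² > 0`, `c ≥ 0`, `N`: `∃E₀ ∀C (e² ≤ E₀) ∃K₀min ∀ 0 ≤ α < 1 ∀K₀ ≥ K₀min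
∃ t δ₀ C > 0` such that for every volume (`d`, `L`, `K₀ ∣ M`), every `1 ≤ k ≤ K` with `L^kε ≤ 1`, `3L^kK₀ ≤ |T_ε|_μ`, every nested pair of
big-block unions `Ω₂ ⊆ Ω`, every `A` `δ_A`-regular on `Ω` with `L^kδ_A|e| ≤ t` and `L^kδ_A ≤ c|e|`, and every margin `r₀`:
`(sect2DeltaRegNested _ C Ω Ω₂ A m² a k K₀ r₀).Ineq25 α δ₀ C`.

## Honest scope / declared divergences (F7)

(i) `distΩ₂ := r₀`, the common margin (in `η`-units) of the admitted localization cubes from `Ω₂ᶜ` (p03's G-B3-14 reading; for cubes filling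
`Ω₂` up to depth `r₀` this is print's `dist(Ω₂,∂Ω)` restricted to the cubes at that depth).  (ii) **The (1.16) alternative of (2.5) is the OTHER
DISPLAY of the row and is NOT MODELLED here** (`norm116 := 0`, `eRun := pRun := 0`, exactly as in p03's three instances): the second conjunct of
`Ineq25` holds trivially and NOTHING is claimed about the operator (1.16).  (iii) The (2.10) fields of the carrier are r14's `regRegionKernels` for
`Ω₂` (so (2.10) for it is r14's theorem, `ineq210_iff_R`); the (2.11)/(2.12) fields stay un-modelled (`0`).  (iv) Interior cubes only, at margin
`≥ r₀L^k`; `m² > 0`; `K₀ ∣ M`, `K₀ ≥ K₀min`, three big blocks a side; `e² ≤ E₀` and `L^kδ_A ≤ c|e|` besides `L^kδ_A|e| ≤ t` (the (I.2.38) input's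
currency in r14's FILE 1; p35's one-parameter form p344601 would remove them); constants depend on `α` and `K₀` (GAPS G-B3-11); localization
functions = sharp unit cubes; `|·|` of a block = operator norm on `ℝ^N → ℝ^N`; contours = `cpath`.  No `def … : Prop`, no new named fact (all
`def`s are concrete data: blocks, field, cubes, carrier); axioms standard.  Value = kernel certificate of one located estimate of B3 §2 at a regular
background on nested regions, NOT summit progress.
-/

noncomputable section

open scoped BigOperators InnerProductSpace Matrix

namespace Literature.MathematicalPhysics.QuantumFieldTheory.Balaban1983to89.B3Ineq25RegularNested

open HiggsLattice (ChargeData ScalarField siteInner covDeriv)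
open HiggsCovariance (propagatorK E)
open HiggsAveraging (blockIter)
open B1Eq230FluctCov (Ix cb)
open B1Eq221Coordinates (fieldCoord)
open B1Ineq234Concrete (profile profile_nonneg' distC distC_le distC_nonneg tdist_self)
open B1Ineq234LevelZero (tdist_comm)
open B1TorusChainTransport (IsTChain hol norm_hol_apply norm_hol_apply_sub_le hol_nil)
open B1TorusCubeCover (half)
open B1TorusRegionHSizes (IsBigBlockUnion isBigBlockUnion_univ)
open B4GaugeCovariance (pathEnd)
open B3Sect2StatementsPart2 (ScaledKernels)
open B3Sect1Statements (norm132)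
open LatticeNorms (supNorm_le holderSeminorm_le)
open B3Ineq210RegularTorus (mesh_eq_pow_mul mesh_mono covDeriv_zero'')
open B3Ineq210RegularRegion (Interior interior_univ regRegionKernels)
open B3Ineq211RegularTorus (IsAdm norm_hol_covDeriv_sub_le_sum_coord)
open B3Ineq210MixedRegularTorus (onb dip norm_covDeriv_dip_le_sum norm_apply_single_le norm_covDeriv_apply_single_le
  abs_fieldCoord_single_le fieldCoord_single_of_ne)
open B3Ineq210MixedRegularRegion (inner_covDeriv_propagatorK_single_R)
open B3Ineq31RegularTorus (cubeDist cubeDist_nonneg cubeDist_comm sep_of_cubes tdist_le_of_same_cube two_lt_sitesPerDir cpath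
  isAdm_cpath pathEnd_cpath cpath_self blockIter_eq_of_mem_cpath PSite PBd hb dirOf baseOf pdist unitV unitD transp sites bonds mem_sites
  cubeB cubeY cubeDist_cubeB_cubeY bonds_spec norm_hol_comp_le)
open B3DeltaPiecesRegularNested (dG dPiece sum_dPiece)
open B3DeltaGkKernelRegularNested (le_distC_of_interior piece_sum_le dG_kernel_bound_explicit dG_kernel_deriv_bound_explicit)
open B3DeltaGkMixedRegularRegion (mixedDeltaTermR deltaGk_mixed_regularRegion)
open B3DeltaGkHolderRegularNested (dHolderTerm dPiece_holder_bound_explicit)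

variable {P : HiggsLattice.Params} {N : ℕ}

/-! ## §0 Arithmetic of the units and of the cubes -/

section Units

variable {k : ℕ}

/-- `unitV > 0`. [folklore] -/
private theorem unitV_pos (P : HiggsLattice.Params) (k : ℕ) : 0 < unitV P k := by
  unfold unitV; have := P.mesh_pos k; have := P.mesh_pos 0; positivity

/-- `unitD > 0`. [folklore] -/
private theorem unitD_pos (P : HiggsLattice.Params) (k : ℕ) : 0 < unitD P k := by
  unfold unitD; have := P.mesh_pos k; have := P.mesh_pos 0; positivity

/-- weakening a decay rate. [folklore] -/
private theorem exp_rate_mono {δ δ' t : ℝ} (h : δ ≤ δ') (ht : 0 ≤ t) : Real.exp (-(δ' * t)) ≤ Real.exp (-(δ * t)) := by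
  rw [Real.exp_le_exp]; nlinarith

/-- monotonicity of a decay factor in the distance. [folklore] -/
private theorem exp_dist_mono {δ s s' : ℝ} (hδ : 0 ≤ δ) (h : s' ≤ s) : Real.exp (-(δ * s)) ≤ Real.exp (-(δ * s')) :=
  Real.exp_le_exp.mpr (neg_le_neg (mul_le_mul_of_nonneg_left h hδ))

/-- An operator norm from its bilinear form: `|⟨w, Xv⟩| ≤ B‖v‖‖w‖` for all `v, w` gives `‖X‖ ≤ B`. [folklore] -/
private theorem opNorm_le_of_inner_le (X : E N →L[ℝ] E N) {B : ℝ} (hB : 0 ≤ B) (h : ∀ v w : E N, |⟪w, X v⟫_ℝ| ≤ B * ‖v‖ * ‖w‖) :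
    ‖X‖ ≤ B := by
  refine ContinuousLinearMap.opNorm_le_bound _ hB fun v => ?_
  have h1 := h v (X v)
  rw [real_inner_self_eq_norm_sq, abs_of_nonneg (sq_nonneg _)] at h1
  by_cases h0 : ‖X v‖ = 0
  · rw [h0]; positivity
  · have hpos : 0 < ‖X v‖ := lt_of_le_of_ne (norm_nonneg _) (Ne.symm h0)
    nlinarith

/-- **Points of two unit cubes are at least the cube distance apart**: `L^k·dist(□(v),□(v′)) ≤ |x − x′|` for `x ∈ □(v)`, `x′ ∈ □(v′)` (all
pairs of cubes, the coincident/adjacent case `dist = 0` included). [cite: Balaban1983Higgs3, (3.1) p.432] [cite: Balaban1982Higgs1, (1.20) p.607] -/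
theorem pow_mul_cubeDist_le_tdist (hk : k ≤ P.K) {x x' : HiggsLattice.Site P 0} {v v' : HiggsLattice.Site P k} (hx : blockIter k x = v)
    (hx' : blockIter k x' = v') : (P.L : ℝ) ^ k * cubeDist k v v' ≤ (HiggsLattice.Site.tdist x x' : ℝ) := by
  by_cases h1 : 1 ≤ cubeDist k v v'
  · have h := sep_of_cubes hk hx hx' h1
    linarith
  · have h0 : cubeDist k v v' = 0 := by
      unfold cubeDist at h1 ⊢
      rw [max_eq_right]
      by_contra hc
      push Not at hc
      have hnat : (1 : ℝ) ≤ (HiggsLattice.Site.tdist v v' : ℝ) - 1 := by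
        have h2 : (1 : ℝ) < (HiggsLattice.Site.tdist v v' : ℝ) := by linarith
        have h3 : 2 ≤ HiggsLattice.Site.tdist v v' := by exact_mod_cast h2
        have h4 : (2 : ℝ) ≤ (HiggsLattice.Site.tdist v v' : ℝ) := by exact_mod_cast h3
        linarith
      exact h1 (hnat.trans (le_max_left _ _))
    rw [h0, mul_zero]
    exact Nat.cast_nonneg _

/-- Hence the top-scale decay factor is below the cube decay factor: `e^{−δ|x−x′|/L^k} ≤ e^{−δ·dist(□(v),□(v′))}`.
[cite: Balaban1983Higgs3, (2.5) p.424, (3.1) p.432] -/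
theorem exp_tdist_le_exp_cubeDist (hk : k ≤ P.K) {x x' : HiggsLattice.Site P 0} {v v' : HiggsLattice.Site P k} (hx : blockIter k x = v)
    (hx' : blockIter k x' = v') {δ : ℝ} (hδ : 0 ≤ δ) :
    Real.exp (-(δ * ((HiggsLattice.Site.tdist x x' : ℝ) / (P.L : ℝ) ^ k))) ≤ Real.exp (-(δ * cubeDist k v v')) := by
  have hT : (0 : ℝ) < (P.L : ℝ) ^ k := pow_pos (by exact_mod_cast P.hL) k
  refine exp_dist_mono hδ ?_
  rw [le_div_iff₀ hT, mul_comm]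
  exact pow_mul_cubeDist_le_tdist hk hx hx'

/-- A margin `≥ r₀L^k` gives a boundary factor `≤ e^{−δr₀}`: `e^{−δR/L^k} ≤ e^{−δr₀}` for `r₀L^k ≤ R`. [cite: Balaban1983Higgs3, (2.5) p.424] -/
theorem exp_margin_le {R r₀ δ : ℝ} (hδ : 0 ≤ δ) (hR : r₀ * (P.L : ℝ) ^ k ≤ R) :
    Real.exp (-(δ * (R / (P.L : ℝ) ^ k))) ≤ Real.exp (-(δ * r₀)) := by
  have hT : (0 : ℝ) < (P.L : ℝ) ^ k := pow_pos (by exact_mod_cast P.hL) k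
  refine exp_dist_mono hδ ?_
  rwa [le_div_iff₀ hT]

end Units

/-! ## §1 The blocks of the kernel of `δG_k(Ω,Ω₂,A)` as maps of `ℝ^N`, the row-differentiated blocks, the row move and the column move -/

section Blocks

variable (C : ChargeData N) (Ω Ω₂ : Finset (HiggsLattice.Site P 0)) (A : HiggsLattice.VecField P 0) (msq a : ℝ) (k : ℕ)

/-- The `N × N` block `δG_k(Ω,Ω₂,A; x, x′) : v ↦ (δG_k δ_{x′}v)(x)` of the kernel, as a map of `ℝ^N`. [cite: Balaban1983Higgs3, (1.16) p.414, (2.5) p.424] -/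
def blockKD (x x' : HiggsLattice.Site P 0) : E N →L[ℝ] E N :=
  LinearMap.toContinuousLinearMap (HiggsCovariance.kernel (dG C Ω Ω₂ A msq a k) x x')

/-- The ROW-DIFFERENTIATED block `v ↦ (D^ε_{A}δG_k δ_{x′}v)(b) = ε^{−1}(U(A_b)δG_k(b₊,x′) − δG_k(b₋,x′))v`.
[cite: Balaban1982Higgs1, (1.7) p.605] [cite: Balaban1983Higgs3, (1.32) p.420] -/
def blockDKD (b : HiggsLattice.PBond P 0) (x' : HiggsLattice.Site P 0) : E N →L[ℝ] E N :=
  (P.mesh 0)⁻¹ • ((C.U (P.mesh 0) (A b)).comp (blockKD C Ω Ω₂ A msq a k b.tgt x') - blockKD C Ω Ω₂ A msq a k b.src x')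

variable {C Ω Ω₂ A msq a k}

/-- `δG_k(x,x′)v = (δG_k δ_{x′}v)(x)`. [cite: Balaban1983Higgs3, (1.16) p.414] -/
theorem blockKD_apply (x x' : HiggsLattice.Site P 0) (v : E N) :
    blockKD C Ω Ω₂ A msq a k x x' v = dG C Ω Ω₂ A msq a k (Pi.single x' v) x := by
  simp [blockKD, HiggsCovariance.kernel]

/-- `(DδG_k)(b,x′)v = (D^ε_AδG_k δ_{x′}v)(b)`. [cite: Balaban1982Higgs1, (1.7) p.605] -/
theorem blockDKD_apply (b : HiggsLattice.PBond P 0) (x' : HiggsLattice.Site P 0) (v : E N) :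
    blockDKD C Ω Ω₂ A msq a k b x' v = covDeriv C A (dG C Ω Ω₂ A msq a k (Pi.single x' v)) b := by
  simp only [blockDKD, _root_.smul_apply, _root_.sub_apply, ContinuousLinearMap.comp_apply, blockKD_apply]
  rfl

/-- `‖δG_k(x,x′)‖ ≤ Σ_{i′}‖(δG_k e_{(x′,i′)})(x)‖` (operator norm below the column sum). [cite: Balaban1983Higgs3, (2.5) p.424] -/
theorem norm_blockKD_le (x x' : HiggsLattice.Site P 0) :
    ‖blockKD C Ω Ω₂ A msq a k x x'‖ ≤ ∑ i' : Ix N, ‖dG C Ω Ω₂ A msq a k (cb P N 0 (x', i')) x‖ := by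
  refine ContinuousLinearMap.opNorm_le_bound _ (Finset.sum_nonneg fun _ _ => norm_nonneg _) fun v => ?_
  rw [blockKD_apply, mul_comm]
  exact norm_apply_single_le _ x' v x

/-- `‖(DδG_k)(b,x′)‖ ≤ Σ_{i′}‖(D^ε_AδG_k e_{(x′,i′)})(b)‖`. [cite: Balaban1983Higgs3, (2.5) p.424] -/
theorem norm_blockDKD_le (b : HiggsLattice.PBond P 0) (x' : HiggsLattice.Site P 0) :
    ‖blockDKD C Ω Ω₂ A msq a k b x'‖ ≤ ∑ i' : Ix N, ‖covDeriv C A (dG C Ω Ω₂ A msq a k (cb P N 0 (x', i'))) b‖ := by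
  refine ContinuousLinearMap.opNorm_le_bound _ (Finset.sum_nonneg fun _ _ => norm_nonneg _) fun v => ?_
  rw [blockDKD_apply, mul_comm]
  exact norm_covDeriv_apply_single_le C A _ x' v b

/-- **The row move**: `‖U(A(Γ))(DδG_k)(⟨x₂,μ⟩,y) − (DδG_k)(⟨x₁,μ⟩,y)‖ ≤ Σ_{i′}‖U(A(Γ))(D^ε_AδG_k e_{(y,i′)})(⟨x₂,μ⟩) − (D^ε_AδG_k e_{(y,i′)})(⟨x₁,μ⟩)‖`.
[cite: Balaban1983Higgs3, (1.32) p.420] -/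
theorem norm_hol_comp_blockDKD_sub_le (x₁ x₂ y : HiggsLattice.Site P 0) (Γ : List (HiggsLattice.Site P 0)) (μ : Fin P.d) :
    ‖(hol C A x₁ Γ).comp (blockDKD C Ω Ω₂ A msq a k ⟨x₂, μ⟩ y) - blockDKD C Ω Ω₂ A msq a k ⟨x₁, μ⟩ y‖
      ≤ ∑ i' : Ix N, ‖hol C A x₁ Γ (covDeriv C A (dG C Ω Ω₂ A msq a k (cb P N 0 (y, i'))) ⟨x₂, μ⟩)
          - covDeriv C A (dG C Ω Ω₂ A msq a k (cb P N 0 (y, i'))) ⟨x₁, μ⟩‖ := by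
  refine ContinuousLinearMap.opNorm_le_bound _ (Finset.sum_nonneg fun _ _ => norm_nonneg _) fun v => ?_
  rw [_root_.sub_apply, ContinuousLinearMap.comp_apply, blockDKD_apply, blockDKD_apply, mul_comm]
  refine (norm_hol_covDeriv_sub_le_sum_coord C A _ _ x₁ x₂ Γ μ).trans ?_
  rw [Fintype.sum_prod_type, Finset.sum_eq_single y, Finset.mul_sum]
  · exact Finset.sum_le_sum fun i' _ => mul_le_mul_of_nonneg_right (abs_fieldCoord_single_le y v _) (norm_nonneg _)
  · intro x _ hx
    exact Finset.sum_eq_zero fun i' _ => by rw [fieldCoord_single_of_ne y v (s := (x, i')) hx, abs_zero, zero_mul]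
  · intro h; exact absurd (Finset.mem_univ y) h

/-- **The adjoint identity of the differentiated kernel of `δG_k`**: `⟨w, (D^ε_AδG_kδ_{x′}v)(b)⟩ = ε^{−1}⟨(δG_k dip_b w)(x′), v⟩` — both regions'
kernels are symmetric (p33 g58's `inner_covDeriv_propagatorK_single_R`). [cite: Balaban1982Higgs1, (2.20) p.610, (1.7) p.605] -/
theorem inner_covDeriv_dG_single (b : HiggsLattice.PBond P 0) (x' : HiggsLattice.Site P 0) (v w : E N) :
    ⟪w, covDeriv C A (dG C Ω Ω₂ A msq a k (Pi.single x' v)) b⟫_ℝ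
      = (P.mesh 0)⁻¹ * ⟪dG C Ω Ω₂ A msq a k (dip C A b w) x', v⟫_ℝ := by
  rw [dG, LinearMap.sub_apply, LinearMap.sub_apply, B1Ineq226RegularRegion.covDeriv_sub', inner_sub_right,
    inner_covDeriv_propagatorK_single_R, inner_covDeriv_propagatorK_single_R, Pi.sub_apply, inner_sub_left, mul_sub]

/-- **The column move** (the path lemma on the column field `ε^{−1}δG_k(dip_b w)`): for a chain `Γ′` from `y₁` to `y₂` inside a set `S` on whose
bonds `‖(D^ε_AδG_k dip_b w)(c)‖ ≤ M_×‖w‖`, `‖(DδG_k)(b,y₂)∘U(A(Γ′))^* − (DδG_k)(b,y₁)‖ ≤ |Γ′|·M_×`.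
[cite: Balaban1983Higgs3, (1.32) p.420] [cite: Balaban1983RegularityDecay, p.578] -/
theorem norm_blockDKD_comp_star_sub_le (hS : ∀ μ, 2 < P.sitesPerDir 0 μ) (b : HiggsLattice.PBond P 0)
    (S : Finset (HiggsLattice.Site P 0)) {Mx : ℝ} (hMx : 0 ≤ Mx)
    (hD : ∀ (c : HiggsLattice.PBond P 0) (w : E N), c.src ∈ S → c.tgt ∈ S →
      ‖covDeriv C A (dG C Ω Ω₂ A msq a k (dip C A b w)) c‖ ≤ Mx * ‖w‖)
    {y₁ : HiggsLattice.Site P 0} {Γ' : List (HiggsLattice.Site P 0)} (hch : IsTChain y₁ Γ') (hΓ : ∀ z ∈ y₁ :: Γ', z ∈ S) :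
    ‖(blockDKD C Ω Ω₂ A msq a k b (pathEnd y₁ Γ')).comp (star (hol C A y₁ Γ')) - blockDKD C Ω Ω₂ A msq a k b y₁‖
      ≤ (Γ'.length : ℝ) * Mx := by
  have hε : 0 < P.mesh 0 := P.mesh_pos 0
  refine opNorm_le_of_inner_le _ (by positivity) fun v w => ?_
  set ψ : ScalarField P 0 N := dG C Ω Ω₂ A msq a k (dip C A b w) with hψ
  have hform : ⟪w, ((blockDKD C Ω Ω₂ A msq a k b (pathEnd y₁ Γ')).comp (star (hol C A y₁ Γ')) - blockDKD C Ω Ω₂ A msq a k b y₁) v⟫_ℝ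
      = (P.mesh 0)⁻¹ * ⟪hol C A y₁ Γ' (ψ (pathEnd y₁ Γ')) - ψ y₁, v⟫_ℝ := by
    rw [_root_.sub_apply, ContinuousLinearMap.comp_apply, inner_sub_right, blockDKD_apply, blockDKD_apply,
      inner_covDeriv_dG_single, inner_covDeriv_dG_single, ContinuousLinearMap.star_eq_adjoint,
      ContinuousLinearMap.adjoint_inner_right, inner_sub_left, mul_sub]
  rw [hform, abs_mul, abs_of_nonneg (inv_nonneg.mpr hε.le)]
  have hpath := norm_hol_apply_sub_le hS C A ψ S (G := Mx * ‖w‖)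
    (fun y μ hy hyμ => hD ⟨y, μ⟩ w hy hyμ) hch hΓ
  have hin : |⟪hol C A y₁ Γ' (ψ (pathEnd y₁ Γ')) - ψ y₁, v⟫_ℝ| ≤ P.mesh 0 * Γ'.length * (Mx * ‖w‖) * ‖v‖ :=
    (abs_real_inner_le_norm _ _).trans (mul_le_mul_of_nonneg_right hpath (norm_nonneg _))
  calc (P.mesh 0)⁻¹ * |⟪hol C A y₁ Γ' (ψ (pathEnd y₁ Γ')) - ψ y₁, v⟫_ℝ|
      ≤ (P.mesh 0)⁻¹ * (P.mesh 0 * Γ'.length * (Mx * ‖w‖) * ‖v‖) := mul_le_mul_of_nonneg_left hin (inv_nonneg.mpr hε.le)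
    _ = (Γ'.length : ℝ) * Mx * ‖v‖ * ‖w‖ * ((P.mesh 0)⁻¹ * P.mesh 0) := by ring
    _ = (Γ'.length : ℝ) * Mx * ‖v‖ * ‖w‖ := by rw [inv_mul_cancel₀ hε.ne', mul_one]

end Blocks

/-! ## §2 The two-variable field `(x,x′) ↦ δG_k(Ω,Ω₂,A;x,x′)` on `□(v) × □(v′)`, the norm (1.32), the admissible cubes and the carrier -/

section Field

variable (C : ChargeData N) (Ω Ω₂ : Finset (HiggsLattice.Site P 0)) (A : HiggsLattice.VecField P 0) (msq a : ℝ) (k : ℕ)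

/-- **The two-variable field of (2.5)** in the print's units for the step `k`: `F(x,x′) = δG_k(Ω,Ω₂,A;x,x′) ∈ Hom(ℝ^N_{x′}, ℝ^N_x)`
(`unitV = (L^kε)^{d−2}ε^{−d}` times the raw block — the `η`-units of p. 414, `η = L^{−k}`). [cite: Balaban1983Higgs3, (2.5) p.424, (1.16) p.414] -/
def kerFD (z : PSite P) : E N →L[ℝ] E N := unitV P k • blockKD C Ω Ω₂ A msq a k z.1 z.2

/-- **The covariant derivatives of `F` along the product bonds** (row bond: `D^η_{A,μ}` in `x`; column bond: `D^η_{A,ν}` in `x′` of the column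
slice `x′ ↦ F(x,x′)^* = δG_k(x′,x)`, by the symmetry of both region kernels) — the row-differentiated block of `hb`, times `unitD = (L^kε)^{d−1}ε^{−d}`.
[cite: Balaban1983Higgs3, (1.32) p.420] -/
def derivFD (c : PBd P) : E N →L[ℝ] E N := unitD P k • blockDKD C Ω Ω₂ A msq a k (hb c).1 (hb c).2

/-- **`‖hδG_k(Ω,Ω₂,A)h′‖_{1,α}` for the regular-background nested-region instance**: the printed (1.32) SUM form `B3Sect1Statements.norm132` of the
two-variable field `F = δG_k(Ω,Ω₂,A;·,·)` on `□(v) × □(v′)` — covariant derivatives in all `2d` directions, transports `U(A(Γ))∘·∘U(A(Γ′))^*` along the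
coordinatewise contours (p40's `transp`), Hölder quotients over same-direction product-bond pairs at the sup-distance `pdist` of their base points,
values in `Hom(ℝ^N, ℝ^N)` with the operator norm (p40's reading of «extends in a natural way to functions of many variables», p. 420, for the
(3.1) files; the same here). [cite: Balaban1983Higgs3, (2.5) p.424, (1.32) p.420] -/
def normHGHD (α : ℝ) (v v' : HiggsLattice.Site P k) : ℝ :=
  norm132 α (fun c c' => dirOf c = dirOf c') (fun c c' => pdist k (baseOf c) (baseOf c')) (transp C A)
    (sites k v v') (bonds k v v') (kerFD C Ω Ω₂ A msq a k) (derivFD C Ω Ω₂ A msq a k)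

/-- **The admissible localization cubes**: the labels `v ∈ T_1^{(k)}` whose unit cube `□(v) = {x : ⌊x/L^k⌋ = v}` consists of INTERIOR points of
`Ω₂` (r14's `Interior k K₀ Ω₂`, Prop. I.2.1's `R₀`-restriction of the kernel entries) at lattice distance `≥ r₀L^k` — `≥ r₀` unit lengths of the
`η`-lattice — from `Ω₂ᶜ` (the cube margin of p03's `B3Ineq25ZeroNest.CubeMargin`, here w.r.t. the fine-lattice distance `distC`).
[cite: Balaban1983Higgs3, (2.5) p.424] [cite: Balaban1982Higgs1, Prop. 2.1 p.610] -/
def LocCube (k K₀ : ℕ) (Ω₂ : Finset (HiggsLattice.Site P 0)) (r₀ : ℕ) : Type :=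
  {v : HiggsLattice.Site P k //
    ∀ x : HiggsLattice.Site P 0, blockIter k x = v → Interior k K₀ Ω₂ x ∧ (r₀ : ℝ) * (P.L : ℝ) ^ k ≤ distC Ω₂ x}

/-- **The concrete carrier of B3 (2.5) for NESTED REGIONS `Ω₂ ⊆ Ω ⊂ T_η` at a REGULAR NON-CONSTANT background `B̃ = A`** at the scale `k` of the
volume `P`, cube parameter `K₀`, margin `r₀`: r14's `regRegionKernels` for `Ω₂` (its (2.10) fields; `Site` = interior points of `Ω₂`) EXTENDED by
the (2.5) data — localization functions `LocFn` = the admissible unit cubes (`LocCube`), `distSupp h h′ = dist(□(v),□(v′))` (`cubeDist`),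
`distΩ₂ := r₀` (the common margin of the admitted cubes, G-B3-14 reading), `normDeltaG α h h′ = ‖hδG_k(Ω,Ω₂,A)h′‖_{1,α}` (`normHGHD`); the (1.16)
alternative is NOT modelled (`norm116 := 0`; `eRun = pRun = 0` from `regRegionKernels`), nor are the (2.11)/(2.12) fields.
[cite: Balaban1983Higgs3, (2.5) p.424, (1.16) p.414] -/
def sect2DeltaRegNested (hL1 : 1 < P.L) (C : ChargeData N) (Ω Ω₂ : Finset (HiggsLattice.Site P 0)) (A : HiggsLattice.VecField P 0)
    (msq a : ℝ) (k K₀ r₀ : ℕ) : ScaledKernels :=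
  { regRegionKernels hL1 C Ω₂ A msq a k K₀ with
    LocFn := LocCube k K₀ Ω₂ r₀
    distSupp := fun v v' => cubeDist k v.1 v'.1
    distΩ₂ := (r₀ : ℝ)
    normDeltaG := fun α v v' => normHGHD C Ω Ω₂ A msq a k α v.1 v'.1
    norm116 := fun _ _ _ _ _ => 0 }

variable {C Ω Ω₂ A msq a k}

/-- `(2.5)` for the carrier unfolds to: the bound on `normHGHD` for every pair of admissible cubes (first conjunct), and the trivially true
(1.16) clause (not modelled). [cite: Balaban1983Higgs3, (2.5) p.424] -/
theorem ineq25_iff {hL1 : 1 < P.L} {K₀ r₀ : ℕ} (α δ₀ Cst : ℝ) :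
    (sect2DeltaRegNested hL1 C Ω Ω₂ A msq a k K₀ r₀).Ineq25 α δ₀ Cst ↔
      (∀ v v' : LocCube k K₀ Ω₂ r₀,
        normHGHD C Ω Ω₂ A msq a k α v.1 v'.1 ≤ Cst * Real.exp (-(δ₀ * (r₀ : ℝ))) * Real.exp (-(δ₀ * cubeDist k v.1 v'.1))) ∧
      (∀ (n n' : ℕ) (_v _v' : LocCube k K₀ Ω₂ r₀), (0 : ℝ) ≤ Cst * ((0 : ℝ) * 0) ^ (n + n') * Real.exp (-(δ₀ * cubeDist k _v.1 _v'.1))) :=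
  Iff.rfl

/-- The (2.10) clause for the carrier IS r14's region statement for `Ω₂` (same fields). [cite: Balaban1983Higgs3, (2.10) p.426] -/
theorem ineq210_iff_R {hL1 : 1 < P.L} {K₀ r₀ : ℕ} (δ₁ Cst : ℝ) :
    (sect2DeltaRegNested hL1 C Ω Ω₂ A msq a k K₀ r₀).Ineq210 δ₁ Cst ↔ (regRegionKernels hL1 C Ω₂ A msq a k K₀).Ineq210 δ₁ Cst :=
  Iff.rfl

/-- **For `Ω₂ = T_ε` (then `Ω = T_ε`, `δG_k = 0`) every unit cube is admissible with any margin** — no restriction in the full-torus case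
(`distC univ x = 0` only bites through `r₀ = 0`; stated for `r₀ = 0`). [cite: Balaban1982Higgs1, Prop. 2.1 p.610] -/
theorem locCube_univ (k K₀ : ℕ) (v : HiggsLattice.Site P k) :
    ∀ x : HiggsLattice.Site P 0, blockIter k x = v →
      Interior k K₀ (Finset.univ : Finset (HiggsLattice.Site P 0)) x ∧ ((0 : ℕ) : ℝ) * (P.L : ℝ) ^ k ≤ distC Finset.univ x :=
  fun x _ => ⟨interior_univ x, by rw [Nat.cast_zero, zero_mul]; exact distC_nonneg _ _⟩

end Field

/-! ## §3 The three parts of `‖hδG_k(Ω,Ω₂,A)h′‖_{1,α}` for admissible cubes, from the four kernel entries AT SCALE `k` at interior points: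
the sup of the kernel, the sup of its derivatives, the Hölder quotients (column move + row move) — ALL pairs of cubes -/

section Parts

variable {k K₀ r₀ : ℕ} {C : ChargeData N} {Ω Ω₂ : Finset (HiggsLattice.Site P 0)} {A : HiggsLattice.VecField P 0} {msq a : ℝ}

/-- kernel: the margin factor of two admissible points is below `e^{−δr₀}`. [cite: Balaban1983Higgs3, (2.5) p.424] -/
private theorem exp_margin_sum_le {x x' : HiggsLattice.Site P 0} {δ : ℝ} (hδ : 0 ≤ δ) (hx : (r₀ : ℝ) * (P.L : ℝ) ^ k ≤ distC Ω₂ x)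
    (x'' : HiggsLattice.Site P 0) (_hx' : (r₀ : ℝ) * (P.L : ℝ) ^ k ≤ distC Ω₂ x'') :
    Real.exp (-(δ * ((distC Ω₂ x + distC Ω₂ x') / (P.L : ℝ) ^ k))) ≤ Real.exp (-(δ * (r₀ : ℝ))) :=
  exp_margin_le hδ (hx.trans (le_add_of_nonneg_right (distC_nonneg _ _)))

/-- **Part 1 — the kernel on `□(v) × □(v′)`** for admissible cubes: `|δG_k(Ω,Ω₂,A;x,x′)| ≤ C_V·e^{−δr₀}·e^{−δdist(□(v),□(v′))}` in the `η`-units, from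
the value entry at scale `k`. [cite: Balaban1983Higgs3, (2.5) p.424] -/
theorem sup_part_leD (hkK : k ≤ P.K) {δ CV : ℝ} (hδ : 0 ≤ δ) (hCV : 0 ≤ CV)
    (hV : ∀ (x x' : HiggsLattice.Site P 0), Interior k K₀ Ω₂ x → Interior k K₀ Ω₂ x' →
      (P.mesh 0 ^ P.d)⁻¹ * ∑ i' : Ix N, ‖dG C Ω Ω₂ A msq a k (cb P N 0 (x', i')) x‖
        ≤ CV * (P.mesh k ^ 2 * (P.mesh k ^ P.d)⁻¹) * Real.exp (-(δ * ((HiggsLattice.Site.tdist x x' : ℝ) / (P.L : ℝ) ^ k))) *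
          Real.exp (-(δ * ((distC Ω₂ x + distC Ω₂ x') / (P.L : ℝ) ^ k))))
    {v v' : HiggsLattice.Site P k} (hv : ∀ x, blockIter k x = v → Interior k K₀ Ω₂ x ∧ (r₀ : ℝ) * (P.L : ℝ) ^ k ≤ distC Ω₂ x)
    (hv' : ∀ x, blockIter k x = v' → Interior k K₀ Ω₂ x ∧ (r₀ : ℝ) * (P.L : ℝ) ^ k ≤ distC Ω₂ x) {z : PSite P} (hz : z ∈ sites k v v') :
    ‖kerFD C Ω Ω₂ A msq a k z‖ ≤ CV * Real.exp (-(δ * (r₀ : ℝ))) * Real.exp (-(δ * cubeDist k v v')) := by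
  obtain ⟨hx, hx'⟩ := mem_sites.1 hz
  have hmk := P.mesh_pos k
  have hU : 0 ≤ P.mesh k ^ P.d * (P.mesh k ^ 2)⁻¹ := by positivity
  have hid : P.mesh k ^ P.d * (P.mesh k ^ 2)⁻¹ * (P.mesh k ^ 2 * (P.mesh k ^ P.d)⁻¹) = 1 := by field_simp
  have hE1 := exp_tdist_le_exp_cubeDist hkK hx hx' hδ
  have hE2 := exp_margin_sum_le (Ω₂ := Ω₂) (x' := z.2) hδ (hv _ hx).2 z.2 (hv' _ hx').2
  rw [kerFD, norm_smul, Real.norm_eq_abs, abs_of_pos (unitV_pos P k)]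
  calc unitV P k * ‖blockKD C Ω Ω₂ A msq a k z.1 z.2‖
      ≤ unitV P k * ∑ i' : Ix N, ‖dG C Ω Ω₂ A msq a k (cb P N 0 (z.2, i')) z.1‖ :=
        mul_le_mul_of_nonneg_left (norm_blockKD_le z.1 z.2) (unitV_pos P k).le
    _ = P.mesh k ^ P.d * (P.mesh k ^ 2)⁻¹ * ((P.mesh 0 ^ P.d)⁻¹ * ∑ i' : Ix N, ‖dG C Ω Ω₂ A msq a k (cb P N 0 (z.2, i')) z.1‖) := by
        rw [unitV]; ring
    _ ≤ P.mesh k ^ P.d * (P.mesh k ^ 2)⁻¹ * (CV * (P.mesh k ^ 2 * (P.mesh k ^ P.d)⁻¹) *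
          Real.exp (-(δ * cubeDist k v v')) * Real.exp (-(δ * (r₀ : ℝ)))) :=
        mul_le_mul_of_nonneg_left ((hV z.1 z.2 (hv _ hx).1 (hv' _ hx').1).trans
          (mul_le_mul (mul_le_mul_of_nonneg_left hE1 (by positivity)) hE2 (Real.exp_pos _).le (by positivity))) hU
    _ = CV * Real.exp (-(δ * (r₀ : ℝ))) * Real.exp (-(δ * cubeDist k v v')) *
          (P.mesh k ^ P.d * (P.mesh k ^ 2)⁻¹ * (P.mesh k ^ 2 * (P.mesh k ^ P.d)⁻¹)) := by ring
    _ = _ := by rw [hid, mul_one]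

/-- **Part 2 — the covariant derivatives on the product bonds** for admissible cubes: `|D^η_{A}δG_k(c)| ≤ C_D·e^{−δr₀}·e^{−δdist}` for row AND column
bonds, from the row-derivative entry at scale `k` (column bonds by the symmetry of the kernel). [cite: Balaban1983Higgs3, (2.5) p.424, (1.32) p.420] -/
theorem deriv_part_leD (hkK : k ≤ P.K) {δ CD : ℝ} (hδ : 0 ≤ δ) (hCD : 0 ≤ CD)
    (hDv : ∀ (μ : Fin P.d) (x x' : HiggsLattice.Site P 0), Interior k K₀ Ω₂ x → Interior k K₀ Ω₂ x' →
      (P.mesh 0 ^ P.d)⁻¹ * ∑ i' : Ix N, ‖covDeriv C A (dG C Ω Ω₂ A msq a k (cb P N 0 (x', i'))) ⟨x, μ⟩‖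
        ≤ CD * (P.mesh k * (P.mesh k ^ P.d)⁻¹) * Real.exp (-(δ * ((HiggsLattice.Site.tdist x x' : ℝ) / (P.L : ℝ) ^ k))) *
          Real.exp (-(δ * ((distC Ω₂ x + distC Ω₂ x') / (P.L : ℝ) ^ k))))
    {v v' : HiggsLattice.Site P k} (hv : ∀ x, blockIter k x = v → Interior k K₀ Ω₂ x ∧ (r₀ : ℝ) * (P.L : ℝ) ^ k ≤ distC Ω₂ x)
    (hv' : ∀ x, blockIter k x = v' → Interior k K₀ Ω₂ x ∧ (r₀ : ℝ) * (P.L : ℝ) ^ k ≤ distC Ω₂ x) {c : PBd P} (hc : c ∈ bonds k v v') :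
    ‖derivFD C Ω Ω₂ A msq a k c‖ ≤ CD * Real.exp (-(δ * (r₀ : ℝ))) * Real.exp (-(δ * cubeDist k v v')) := by
  obtain ⟨hbs, -, hy, -, -⟩ := bonds_spec hc
  have hvb : ∀ x, blockIter k x = cubeB v v' c → Interior k K₀ Ω₂ x ∧ (r₀ : ℝ) * (P.L : ℝ) ^ k ≤ distC Ω₂ x := by
    rcases c with c | c
    · exact hv
    · exact hv'
  have hvy : ∀ x, blockIter k x = cubeY v v' c → Interior k K₀ Ω₂ x ∧ (r₀ : ℝ) * (P.L : ℝ) ^ k ≤ distC Ω₂ x := by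
    rcases c with c | c
    · exact hv'
    · exact hv
  rw [← cubeDist_cubeB_cubeY v v' c]
  unfold derivFD
  generalize cubeB v v' c = vb at hbs hvb ⊢
  generalize cubeY v v' c = vy at hy hvy ⊢
  generalize (hb c).1 = b at hbs ⊢
  generalize (hb c).2 = y at hy ⊢
  obtain ⟨x, μ⟩ := b
  have hmk := P.mesh_pos k
  have hU : 0 ≤ P.mesh k ^ P.d * (P.mesh k)⁻¹ := by positivity
  have hid : P.mesh k ^ P.d * (P.mesh k)⁻¹ * (P.mesh k * (P.mesh k ^ P.d)⁻¹) = 1 := by field_simp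
  have hE1 := exp_tdist_le_exp_cubeDist hkK hbs hy hδ
  have hE2 := exp_margin_sum_le (Ω₂ := Ω₂) (x' := y) hδ (hvb _ hbs).2 y (hvy _ hy).2
  rw [norm_smul, Real.norm_eq_abs, abs_of_pos (unitD_pos P k)]
  calc unitD P k * ‖blockDKD C Ω Ω₂ A msq a k ⟨x, μ⟩ y‖
      ≤ unitD P k * ∑ i' : Ix N, ‖covDeriv C A (dG C Ω Ω₂ A msq a k (cb P N 0 (y, i'))) ⟨x, μ⟩‖ :=
        mul_le_mul_of_nonneg_left (norm_blockDKD_le _ y) (unitD_pos P k).le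
    _ = P.mesh k ^ P.d * (P.mesh k)⁻¹ *
          ((P.mesh 0 ^ P.d)⁻¹ * ∑ i' : Ix N, ‖covDeriv C A (dG C Ω Ω₂ A msq a k (cb P N 0 (y, i'))) ⟨x, μ⟩‖) := by
        rw [unitD]; ring
    _ ≤ P.mesh k ^ P.d * (P.mesh k)⁻¹ * (CD * (P.mesh k * (P.mesh k ^ P.d)⁻¹) *
          Real.exp (-(δ * cubeDist k vb vy)) * Real.exp (-(δ * (r₀ : ℝ)))) :=
        mul_le_mul_of_nonneg_left ((hDv μ x y (hvb _ hbs).1 (hvy _ hy).1).trans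
          (mul_le_mul (mul_le_mul_of_nonneg_left hE1 (by positivity)) hE2 (Real.exp_pos _).le (by positivity))) hU
    _ = CD * Real.exp (-(δ * (r₀ : ℝ))) * Real.exp (-(δ * cubeDist k vb vy)) *
          (P.mesh k ^ P.d * (P.mesh k)⁻¹ * (P.mesh k * (P.mesh k ^ P.d)⁻¹)) := by ring
    _ = _ := by rw [hid, mul_one]

/-- **Part 3a — the column move** `(DδG_k)(b,y₂)∘U(A(Γ_{y₁,y₂}))^* − (DδG_k)(b,y₁)` for `b` over the admissible cube `□(v_b)`, `y₁, y₂ ∈ □(v_y)`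
admissible: bounded by `d|y₁−y₂|·M_×`, `M_× = ε^dε·C_M(L^kε)^{−d}e^{−δr₀}e^{−δdist}` the bound of the mixed entry at scale `k` on the bonds of `□(v_y)`
(the contour stays in the cube). [cite: Balaban1983Higgs3, (1.32) p.420, (2.5) p.424] -/
theorem termA_leD (hS : ∀ μ, 2 < P.sitesPerDir 0 μ) (hkK : k ≤ P.K) {δ CM : ℝ} (hδ : 0 ≤ δ) (hCM : 0 ≤ CM)
    (hM : ∀ (μ ν : Fin P.d) (x x' : HiggsLattice.Site P 0), Interior k K₀ Ω₂ x → Interior k K₀ Ω₂ x' →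
      (P.mesh 0 ^ P.d)⁻¹ * ((P.mesh 0)⁻¹ *
          ∑ i : Ix N, ‖covDeriv C A (dG C Ω Ω₂ A msq a k (dip C A ⟨x', ν⟩ (onb N i))) ⟨x, μ⟩‖)
        ≤ CM * (P.mesh k ^ P.d)⁻¹ * Real.exp (-(δ * ((HiggsLattice.Site.tdist x x' : ℝ) / (P.L : ℝ) ^ k))) *
          Real.exp (-(δ * ((distC Ω₂ x + distC Ω₂ x') / (P.L : ℝ) ^ k))))
    {vb vy : HiggsLattice.Site P k} (hvb : ∀ x, blockIter k x = vb → Interior k K₀ Ω₂ x ∧ (r₀ : ℝ) * (P.L : ℝ) ^ k ≤ distC Ω₂ x)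
    (hvy : ∀ x, blockIter k x = vy → Interior k K₀ Ω₂ x ∧ (r₀ : ℝ) * (P.L : ℝ) ^ k ≤ distC Ω₂ x) {b : HiggsLattice.PBond P 0}
    (hbv : blockIter k b.src = vb) {y₁ y₂ : HiggsLattice.Site P 0} (hy₁ : blockIter k y₁ = vy) (hy₂ : blockIter k y₂ = vy) :
    ‖(blockDKD C Ω Ω₂ A msq a k b y₂).comp (star (hol C A y₁ (cpath y₁ y₂))) - blockDKD C Ω Ω₂ A msq a k b y₁‖
      ≤ (P.d : ℝ) * (HiggsLattice.Site.tdist y₁ y₂ : ℝ) *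
          (P.mesh 0 ^ P.d * P.mesh 0 *
            (CM * (P.mesh k ^ P.d)⁻¹ * Real.exp (-(δ * (r₀ : ℝ))) * Real.exp (-(δ * cubeDist k vb vy)))) := by
  classical
  obtain ⟨xb, ν⟩ := b
  replace hbv : blockIter k xb = vb := hbv
  have hε : 0 ≤ P.mesh 0 ^ P.d * P.mesh 0 := by have := P.mesh_pos 0; positivity
  obtain ⟨Mx, hMx⟩ : ∃ Mx : ℝ, Mx = P.mesh 0 ^ P.d * P.mesh 0 *
      (CM * (P.mesh k ^ P.d)⁻¹ * Real.exp (-(δ * (r₀ : ℝ))) * Real.exp (-(δ * cubeDist k vb vy))) := ⟨_, rfl⟩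
  have hMx0 : 0 ≤ Mx := by rw [hMx]; have := P.mesh_pos k; positivity
  obtain ⟨S, hS'⟩ : ∃ S : Finset (HiggsLattice.Site P 0), S = Finset.univ.filter fun z => blockIter k z = vy := ⟨_, rfl⟩
  have hadm := isAdm_cpath y₁ y₂
  have hD : ∀ (c : HiggsLattice.PBond P 0) (w : E N), c.src ∈ S → c.tgt ∈ S →
      ‖covDeriv C A (dG C Ω Ω₂ A msq a k (dip C A ⟨xb, ν⟩ w)) c‖ ≤ Mx * ‖w‖ := by
    intro c w hc _
    obtain ⟨xc, μ⟩ := c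
    have hcv : blockIter k xc = vy := by rw [hS', Finset.mem_filter] at hc; exact hc.2
    have hE1 : Real.exp (-(δ * ((HiggsLattice.Site.tdist xc xb : ℝ) / (P.L : ℝ) ^ k))) ≤ Real.exp (-(δ * cubeDist k vb vy)) := by
      rw [cubeDist_comm]; exact exp_tdist_le_exp_cubeDist hkK hcv hbv hδ
    have hE2 := exp_margin_sum_le (Ω₂ := Ω₂) (x' := xb) hδ (hvy _ hcv).2 xb (hvb _ hbv).2
    have hε0 : P.mesh 0 ≠ 0 := (P.mesh_pos 0).ne'
    have hsum : ∑ i : Ix N, ‖covDeriv C A (dG C Ω Ω₂ A msq a k (dip C A ⟨xb, ν⟩ (onb N i))) ⟨xc, μ⟩‖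
        = P.mesh 0 ^ P.d * P.mesh 0 * ((P.mesh 0 ^ P.d)⁻¹ * ((P.mesh 0)⁻¹ *
          ∑ i : Ix N, ‖covDeriv C A (dG C Ω Ω₂ A msq a k (dip C A ⟨xb, ν⟩ (onb N i))) ⟨xc, μ⟩‖)) := by
      field_simp
    calc ‖covDeriv C A (dG C Ω Ω₂ A msq a k (dip C A ⟨xb, ν⟩ w)) ⟨xc, μ⟩‖
        ≤ ‖w‖ * ∑ i : Ix N, ‖covDeriv C A (dG C Ω Ω₂ A msq a k (dip C A ⟨xb, ν⟩ (onb N i))) ⟨xc, μ⟩‖ :=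
          norm_covDeriv_dip_le_sum (dG C Ω Ω₂ A msq a k) _ _ w
      _ ≤ ‖w‖ * Mx := by
          refine mul_le_mul_of_nonneg_left ?_ (norm_nonneg _)
          rw [hsum, hMx]
          refine mul_le_mul_of_nonneg_left ((hM μ ν xc xb (hvy _ hcv).1 (hvb _ hbv).1).trans ?_) hε
          have := P.mesh_pos k
          exact mul_le_mul (mul_le_mul_of_nonneg_left hE1 (by positivity)) hE2 (Real.exp_pos _).le (by positivity) |>.trans
            (le_of_eq (by ring))
      _ = Mx * ‖w‖ := mul_comm _ _
  have h := norm_blockDKD_comp_star_sub_le (Ω := Ω) (Ω₂ := Ω₂) (msq := msq) (a := a) (k := k) hS ⟨xb, ν⟩ S hMx0 hD hadm.1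
    (fun z hz => by rw [hS', Finset.mem_filter]; exact ⟨Finset.mem_univ _, blockIter_eq_of_mem_cpath hkK hy₁ hy₂ z hz⟩)
  rw [pathEnd_cpath] at h
  rw [← hMx]
  exact h.trans (mul_le_mul_of_nonneg_right hadm.2.2 hMx0)

/-- kernel: the Hölder weight identity `(ε|x₁−x₂|)^α·((L^kε)^α)^{−1} = (|x₁−x₂|/L^k)^α`. [cite: Balaban1983Higgs3, (2.11) p.426] -/
private theorem weight_top_eq (k : ℕ) {t α : ℝ} (ht : 0 ≤ t) :
    (P.mesh 0 * t) ^ α * (P.mesh k ^ α)⁻¹ = (t / (P.L : ℝ) ^ k) ^ α := by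
  have hm0 : 0 < P.mesh 0 := P.mesh_pos 0
  have hmk : 0 < P.mesh k := P.mesh_pos k
  have e : t / (P.L : ℝ) ^ k = (P.mesh 0 * t) / P.mesh k := by
    rw [mesh_eq_pow_mul P k]
    have hLk : (P.L : ℝ) ^ k ≠ 0 := (pow_pos (by exact_mod_cast P.hL) k).ne'
    field_simp
  rw [e, Real.div_rpow (by positivity) hmk.le, div_eq_mul_inv]

/-- **Part 3b — the row move** `U(A(Γ_{x₁,x₂}))(DδG_k)(⟨x₂,μ⟩,y) − (DδG_k)(⟨x₁,μ⟩,y)` in the print's units, `x₁, x₂ ∈ □(v_b)`, `y ∈ □(v_y)`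
admissible: bounded by `p^α·C_He^{−δr₀}e^{−δdist}` for any `p ≥ |x₁−x₂|/L^k`, from the Hölder entry at scale `k` along `Γ_{x₁,x₂} = cpath`.
[cite: Balaban1983Higgs3, (1.32) p.420, (2.5) p.424, (2.11) p.426] -/
theorem termB_leD (hkK : k ≤ P.K) {α δ CH : ℝ} (hα0 : 0 ≤ α) (hδ : 0 ≤ δ) (hCH : 0 ≤ CH)
    (hH : ∀ (μ : Fin P.d) (x₁ x₂ x' : HiggsLattice.Site P 0) (Γ : List (HiggsLattice.Site P 0)),
      Interior k K₀ Ω₂ x₁ → Interior k K₀ Ω₂ x₂ → Interior k K₀ Ω₂ x' → x₁ ≠ x₂ → IsAdm x₁ x₂ Γ →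
      (P.mesh 0 ^ P.d)⁻¹ * ∑ i' : Ix N, ‖hol C A x₁ Γ (covDeriv C A (dG C Ω Ω₂ A msq a k (cb P N 0 (x', i'))) ⟨x₂, μ⟩)
          - covDeriv C A (dG C Ω Ω₂ A msq a k (cb P N 0 (x', i'))) ⟨x₁, μ⟩‖
        ≤ (P.mesh 0 * (HiggsLattice.Site.tdist x₁ x₂ : ℝ)) ^ α * (CH * (P.mesh k * (P.mesh k ^ P.d)⁻¹ * (P.mesh k ^ α)⁻¹)) *
          Real.exp (-(δ * (min (HiggsLattice.Site.tdist x₁ x' : ℝ) (HiggsLattice.Site.tdist x₂ x' : ℝ) / (P.L : ℝ) ^ k))) *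
          Real.exp (-(δ * (min (min (distC Ω₂ x₁) (distC Ω₂ x₂)) (distC Ω₂ x') / (P.L : ℝ) ^ k))))
    {vb vy : HiggsLattice.Site P k} (hvb : ∀ x, blockIter k x = vb → Interior k K₀ Ω₂ x ∧ (r₀ : ℝ) * (P.L : ℝ) ^ k ≤ distC Ω₂ x)
    (hvy : ∀ x, blockIter k x = vy → Interior k K₀ Ω₂ x ∧ (r₀ : ℝ) * (P.L : ℝ) ^ k ≤ distC Ω₂ x) {x₁ x₂ y : HiggsLattice.Site P 0}
    (μ : Fin P.d) (hx₁ : blockIter k x₁ = vb) (hx₂ : blockIter k x₂ = vb) (hy : blockIter k y = vy) {pd : ℝ}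
    (hpd : (HiggsLattice.Site.tdist x₁ x₂ : ℝ) / (P.L : ℝ) ^ k ≤ pd) :
    unitD P k * ‖(hol C A x₁ (cpath x₁ x₂)).comp (blockDKD C Ω Ω₂ A msq a k ⟨x₂, μ⟩ y) - blockDKD C Ω Ω₂ A msq a k ⟨x₁, μ⟩ y‖
      ≤ pd ^ α * (CH * Real.exp (-(δ * (r₀ : ℝ))) * Real.exp (-(δ * cubeDist k vb vy))) := by
  have hL0 : (0 : ℝ) < P.L := by exact_mod_cast (lt_of_lt_of_le zero_lt_one P.hL)
  have hLk : (0 : ℝ) < (P.L : ℝ) ^ k := pow_pos hL0 k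
  have hpd0 : 0 ≤ pd := le_trans (by positivity) hpd
  by_cases hx : x₁ = x₂
  · subst hx
    rw [cpath_self, hol_nil, ContinuousLinearMap.one_def, ContinuousLinearMap.id_comp, sub_self, norm_zero, mul_zero]
    positivity
  have hmk := P.mesh_pos k
  have hm0 := P.mesh_pos 0
  have hU : 0 ≤ P.mesh k ^ P.d * (P.mesh k)⁻¹ := by positivity
  -- the two decay factors
  have hE1 : Real.exp (-(δ * (min (HiggsLattice.Site.tdist x₁ y : ℝ) (HiggsLattice.Site.tdist x₂ y : ℝ) / (P.L : ℝ) ^ k)))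
      ≤ Real.exp (-(δ * cubeDist k vb vy)) := by
    refine exp_dist_mono hδ ?_
    rw [le_div_iff₀ hLk, mul_comm]
    exact le_min (pow_mul_cubeDist_le_tdist hkK hx₁ hy) (pow_mul_cubeDist_le_tdist hkK hx₂ hy)
  have hE2 : Real.exp (-(δ * (min (min (distC Ω₂ x₁) (distC Ω₂ x₂)) (distC Ω₂ y) / (P.L : ℝ) ^ k))) ≤ Real.exp (-(δ * (r₀ : ℝ))) :=
    exp_margin_le hδ (le_min (le_min (hvb _ hx₁).2 (hvb _ hx₂).2) (hvy _ hy).2)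
  -- the weight
  have ht0 : 0 ≤ (HiggsLattice.Site.tdist x₁ x₂ : ℝ) := Nat.cast_nonneg _
  have hwt : (P.mesh 0 * (HiggsLattice.Site.tdist x₁ x₂ : ℝ)) ^ α * (P.mesh k ^ α)⁻¹ ≤ pd ^ α := by
    rw [weight_top_eq k ht0]
    exact Real.rpow_le_rpow (by positivity) hpd hα0
  have hwt0 : 0 ≤ (P.mesh 0 * (HiggsLattice.Site.tdist x₁ x₂ : ℝ)) ^ α * (P.mesh k ^ α)⁻¹ := by
    rw [weight_top_eq k ht0]; positivity
  have hid : P.mesh k ^ P.d * (P.mesh k)⁻¹ * (P.mesh k * (P.mesh k ^ P.d)⁻¹) = 1 := by field_simp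
  calc unitD P k * ‖(hol C A x₁ (cpath x₁ x₂)).comp (blockDKD C Ω Ω₂ A msq a k ⟨x₂, μ⟩ y) - blockDKD C Ω Ω₂ A msq a k ⟨x₁, μ⟩ y‖
      ≤ unitD P k * ∑ i' : Ix N, ‖hol C A x₁ (cpath x₁ x₂) (covDeriv C A (dG C Ω Ω₂ A msq a k (cb P N 0 (y, i'))) ⟨x₂, μ⟩)
          - covDeriv C A (dG C Ω Ω₂ A msq a k (cb P N 0 (y, i'))) ⟨x₁, μ⟩‖ :=
        mul_le_mul_of_nonneg_left (norm_hol_comp_blockDKD_sub_le x₁ x₂ y _ μ) (unitD_pos P k).le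
    _ = P.mesh k ^ P.d * (P.mesh k)⁻¹ * ((P.mesh 0 ^ P.d)⁻¹ * ∑ i' : Ix N,
          ‖hol C A x₁ (cpath x₁ x₂) (covDeriv C A (dG C Ω Ω₂ A msq a k (cb P N 0 (y, i'))) ⟨x₂, μ⟩)
            - covDeriv C A (dG C Ω Ω₂ A msq a k (cb P N 0 (y, i'))) ⟨x₁, μ⟩‖) := by rw [unitD]; ring
    _ ≤ P.mesh k ^ P.d * (P.mesh k)⁻¹ * ((P.mesh 0 * (HiggsLattice.Site.tdist x₁ x₂ : ℝ)) ^ α *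
          (CH * (P.mesh k * (P.mesh k ^ P.d)⁻¹ * (P.mesh k ^ α)⁻¹)) *
          Real.exp (-(δ * cubeDist k vb vy)) * Real.exp (-(δ * (r₀ : ℝ)))) := by
        refine mul_le_mul_of_nonneg_left ((hH μ x₁ x₂ y _ (hvb _ hx₁).1 (hvb _ hx₂).1 (hvy _ hy).1 hx (isAdm_cpath x₁ x₂)).trans ?_) hU
        have h0 : 0 ≤ (P.mesh 0 * (HiggsLattice.Site.tdist x₁ x₂ : ℝ)) ^ α * (CH * (P.mesh k * (P.mesh k ^ P.d)⁻¹ * (P.mesh k ^ α)⁻¹)) := by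
          have : 0 ≤ (P.mesh 0 * (HiggsLattice.Site.tdist x₁ x₂ : ℝ)) ^ α := Real.rpow_nonneg (by positivity) _
          have : 0 < P.mesh k ^ α := Real.rpow_pos_of_pos hmk α
          positivity
        exact mul_le_mul (mul_le_mul_of_nonneg_left hE1 h0) hE2 (Real.exp_pos _).le (mul_nonneg h0 (Real.exp_pos _).le)
    _ = ((P.mesh 0 * (HiggsLattice.Site.tdist x₁ x₂ : ℝ)) ^ α * (P.mesh k ^ α)⁻¹) *
          (CH * Real.exp (-(δ * (r₀ : ℝ))) * Real.exp (-(δ * cubeDist k vb vy))) *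
          (P.mesh k ^ P.d * (P.mesh k)⁻¹ * (P.mesh k * (P.mesh k ^ P.d)⁻¹)) := by ring
    _ ≤ pd ^ α * (CH * Real.exp (-(δ * (r₀ : ℝ))) * Real.exp (-(δ * cubeDist k vb vy))) := by
        rw [hid, mul_one]; exact mul_le_mul_of_nonneg_right hwt (by positivity)

/-- **Part 3, the core estimate for one same-direction pair** in explicit variables (admissible cubes): bonds `⟨x₁,μ⟩, ⟨x₂,μ⟩` over `□(v_b)`,
other sites `y₁, y₂ ∈ □(v_y)`: `(L^kε)^{d−1}ε^{−d}‖U(A(Γ_{x₁,x₂}))(DδG_k)(⟨x₂,μ⟩,y₂)U(A(Γ_{y₁,y₂}))^* − (DδG_k)(⟨x₁,μ⟩,y₁)‖ ≤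
(C_H + dC_M)e^{−δr₀}e^{−δdist}·(max(|x₁−x₂|,|y₁−y₂|)/L^k)^α` — triangle through `(DδG_k)(⟨x₂,μ⟩,y₁)`: column move (Part 3a, one factor
`|y₁−y₂|/L^k ≤ p ≤ p^α` as `p ≤ 1` inside a unit cube) plus row move (Part 3b). [cite: Balaban1983Higgs3, (2.5) p.424, (1.32) p.420] -/
theorem holder_coreD (hS : ∀ μ, 2 < P.sitesPerDir 0 μ) (hkK : k ≤ P.K) {α δ CH CM : ℝ} (hα0 : 0 ≤ α) (hα1 : α ≤ 1) (hδ : 0 ≤ δ)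
    (hCH : 0 ≤ CH) (hCM : 0 ≤ CM)
    (hH : ∀ (μ : Fin P.d) (x₁ x₂ x' : HiggsLattice.Site P 0) (Γ : List (HiggsLattice.Site P 0)),
      Interior k K₀ Ω₂ x₁ → Interior k K₀ Ω₂ x₂ → Interior k K₀ Ω₂ x' → x₁ ≠ x₂ → IsAdm x₁ x₂ Γ →
      (P.mesh 0 ^ P.d)⁻¹ * ∑ i' : Ix N, ‖hol C A x₁ Γ (covDeriv C A (dG C Ω Ω₂ A msq a k (cb P N 0 (x', i'))) ⟨x₂, μ⟩)
          - covDeriv C A (dG C Ω Ω₂ A msq a k (cb P N 0 (x', i'))) ⟨x₁, μ⟩‖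
        ≤ (P.mesh 0 * (HiggsLattice.Site.tdist x₁ x₂ : ℝ)) ^ α * (CH * (P.mesh k * (P.mesh k ^ P.d)⁻¹ * (P.mesh k ^ α)⁻¹)) *
          Real.exp (-(δ * (min (HiggsLattice.Site.tdist x₁ x' : ℝ) (HiggsLattice.Site.tdist x₂ x' : ℝ) / (P.L : ℝ) ^ k))) *
          Real.exp (-(δ * (min (min (distC Ω₂ x₁) (distC Ω₂ x₂)) (distC Ω₂ x') / (P.L : ℝ) ^ k))))
    (hM : ∀ (μ ν : Fin P.d) (x x' : HiggsLattice.Site P 0), Interior k K₀ Ω₂ x → Interior k K₀ Ω₂ x' →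
      (P.mesh 0 ^ P.d)⁻¹ * ((P.mesh 0)⁻¹ *
          ∑ i : Ix N, ‖covDeriv C A (dG C Ω Ω₂ A msq a k (dip C A ⟨x', ν⟩ (onb N i))) ⟨x, μ⟩‖)
        ≤ CM * (P.mesh k ^ P.d)⁻¹ * Real.exp (-(δ * ((HiggsLattice.Site.tdist x x' : ℝ) / (P.L : ℝ) ^ k))) *
          Real.exp (-(δ * ((distC Ω₂ x + distC Ω₂ x') / (P.L : ℝ) ^ k))))
    {vb vy : HiggsLattice.Site P k} (hvb : ∀ x, blockIter k x = vb → Interior k K₀ Ω₂ x ∧ (r₀ : ℝ) * (P.L : ℝ) ^ k ≤ distC Ω₂ x)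
    (hvy : ∀ x, blockIter k x = vy → Interior k K₀ Ω₂ x ∧ (r₀ : ℝ) * (P.L : ℝ) ^ k ≤ distC Ω₂ x) {x₁ x₂ y₁ y₂ : HiggsLattice.Site P 0}
    (μ : Fin P.d) (hx₁ : blockIter k x₁ = vb) (hx₂ : blockIter k x₂ = vb) (hy₁ : blockIter k y₁ = vy) (hy₂ : blockIter k y₂ = vy)
    (hpos : 0 < max (HiggsLattice.Site.tdist x₁ x₂ : ℝ) (HiggsLattice.Site.tdist y₁ y₂ : ℝ) / (P.L : ℝ) ^ k) :
    ‖(hol C A x₁ (cpath x₁ x₂)).comp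
          ((unitD P k • blockDKD C Ω Ω₂ A msq a k ⟨x₂, μ⟩ y₂).comp (star (hol C A y₁ (cpath y₁ y₂))))
        - unitD P k • blockDKD C Ω Ω₂ A msq a k ⟨x₁, μ⟩ y₁‖
      ≤ (CH + P.d * CM) * Real.exp (-(δ * (r₀ : ℝ))) * Real.exp (-(δ * cubeDist k vb vy)) *
          (max (HiggsLattice.Site.tdist x₁ x₂ : ℝ) (HiggsLattice.Site.tdist y₁ y₂ : ℝ) / (P.L : ℝ) ^ k) ^ α := by
  have hL0 : (0 : ℝ) < P.L := by exact_mod_cast (lt_of_lt_of_le zero_lt_one P.hL)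
  have hLk : (0 : ℝ) < (P.L : ℝ) ^ k := pow_pos hL0 k
  obtain ⟨pd, hpd⟩ : ∃ pd : ℝ,
      pd = max (HiggsLattice.Site.tdist x₁ x₂ : ℝ) (HiggsLattice.Site.tdist y₁ y₂ : ℝ) / (P.L : ℝ) ^ k := ⟨_, rfl⟩
  rw [← hpd] at hpos ⊢
  have htb : (HiggsLattice.Site.tdist x₁ x₂ : ℝ) / (P.L : ℝ) ^ k ≤ pd := by
    rw [hpd]; exact div_le_div_of_nonneg_right (le_max_left _ _) hLk.le
  have hty : (HiggsLattice.Site.tdist y₁ y₂ : ℝ) / (P.L : ℝ) ^ k ≤ pd := by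
    rw [hpd]; exact div_le_div_of_nonneg_right (le_max_right _ _) hLk.le
  have hpd1 : pd ≤ 1 := by
    rw [hpd, div_le_one hLk]
    have h₁ := tdist_le_of_same_cube hkK hx₁ hx₂
    have h₂ := tdist_le_of_same_cube hkK hy₁ hy₂
    exact max_le (by linarith) (by linarith)
  have hpdα : pd ≤ pd ^ α := by
    conv_lhs => rw [← Real.rpow_one pd]
    exact Real.rpow_le_rpow_of_exponent_ge hpos hpd1 hα1
  have e : (hol C A x₁ (cpath x₁ x₂)).comp
          ((unitD P k • blockDKD C Ω Ω₂ A msq a k ⟨x₂, μ⟩ y₂).comp (star (hol C A y₁ (cpath y₁ y₂))))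
        - unitD P k • blockDKD C Ω Ω₂ A msq a k ⟨x₁, μ⟩ y₁
      = unitD P k • ((hol C A x₁ (cpath x₁ x₂)).comp
          ((blockDKD C Ω Ω₂ A msq a k ⟨x₂, μ⟩ y₂).comp (star (hol C A y₁ (cpath y₁ y₂))) - blockDKD C Ω Ω₂ A msq a k ⟨x₂, μ⟩ y₁) +
        ((hol C A x₁ (cpath x₁ x₂)).comp (blockDKD C Ω Ω₂ A msq a k ⟨x₂, μ⟩ y₁) - blockDKD C Ω Ω₂ A msq a k ⟨x₁, μ⟩ y₁)) := by
    rw [ContinuousLinearMap.smul_comp, ContinuousLinearMap.comp_smul, ContinuousLinearMap.comp_sub, sub_add_sub_cancel,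
      smul_sub]
  rw [e, norm_smul, Real.norm_eq_abs, abs_of_pos (unitD_pos P k)]
  have hA := termA_leD (Ω := Ω) (msq := msq) (a := a) hS hkK hδ hCM hM hvb hvy (b := ⟨x₂, μ⟩) hx₂ hy₁ hy₂
  have hB := termB_leD (Ω := Ω) (msq := msq) (a := a) hkK hα0 hδ hCH hH hvb hvy μ hx₁ hx₂ hy₁ htb
  have hu : unitD P k * (P.mesh 0 ^ P.d * P.mesh 0) * (P.mesh k ^ P.d)⁻¹ = ((P.L : ℝ) ^ k)⁻¹ := by
    unfold unitD
    rw [mesh_eq_pow_mul P k]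
    have hε0 : P.mesh 0 ≠ 0 := (P.mesh_pos 0).ne'
    have hLk0 : (P.L : ℝ) ^ k ≠ 0 := hLk.ne'
    field_simp
  obtain ⟨TA, hTA⟩ : ∃ T : E N →L[ℝ] E N,
      (blockDKD C Ω Ω₂ A msq a k ⟨x₂, μ⟩ y₂).comp (star (hol C A y₁ (cpath y₁ y₂))) - blockDKD C Ω Ω₂ A msq a k ⟨x₂, μ⟩ y₁ = T :=
    ⟨_, rfl⟩
  obtain ⟨TB, hTB⟩ : ∃ T : E N →L[ℝ] E N,
      (hol C A x₁ (cpath x₁ x₂)).comp (blockDKD C Ω Ω₂ A msq a k ⟨x₂, μ⟩ y₁) - blockDKD C Ω Ω₂ A msq a k ⟨x₁, μ⟩ y₁ = T := ⟨_, rfl⟩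
  rw [hTA] at hA ⊢
  rw [hTB] at hB ⊢
  have hu0 := (unitD_pos P k).le
  have hX : ‖(hol C A x₁ (cpath x₁ x₂)).comp TA‖ ≤ ‖TA‖ := norm_hol_comp_le _ _ _
  have hK0 : 0 ≤ CM * Real.exp (-(δ * (r₀ : ℝ))) * Real.exp (-(δ * cubeDist k vb vy)) := by positivity
  calc unitD P k * ‖(hol C A x₁ (cpath x₁ x₂)).comp TA + TB‖
      ≤ unitD P k * (‖TA‖ + ‖TB‖) := mul_le_mul_of_nonneg_left ((norm_add_le _ _).trans (add_le_add hX le_rfl)) hu0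
    _ = unitD P k * ‖TA‖ + unitD P k * ‖TB‖ := mul_add _ _ _
    _ ≤ unitD P k * ((P.d : ℝ) * (HiggsLattice.Site.tdist y₁ y₂ : ℝ) * (P.mesh 0 ^ P.d * P.mesh 0 *
            (CM * (P.mesh k ^ P.d)⁻¹ * Real.exp (-(δ * (r₀ : ℝ))) * Real.exp (-(δ * cubeDist k vb vy))))) +
          pd ^ α * (CH * Real.exp (-(δ * (r₀ : ℝ))) * Real.exp (-(δ * cubeDist k vb vy))) :=
        add_le_add (mul_le_mul_of_nonneg_left hA hu0) hB
    _ = (P.d : ℝ) * ((HiggsLattice.Site.tdist y₁ y₂ : ℝ) * (unitD P k * (P.mesh 0 ^ P.d * P.mesh 0) * (P.mesh k ^ P.d)⁻¹)) *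
            (CM * Real.exp (-(δ * (r₀ : ℝ))) * Real.exp (-(δ * cubeDist k vb vy))) +
          pd ^ α * (CH * Real.exp (-(δ * (r₀ : ℝ))) * Real.exp (-(δ * cubeDist k vb vy))) := by ring
    _ = (P.d : ℝ) * ((HiggsLattice.Site.tdist y₁ y₂ : ℝ) / (P.L : ℝ) ^ k) *
            (CM * Real.exp (-(δ * (r₀ : ℝ))) * Real.exp (-(δ * cubeDist k vb vy))) +
          pd ^ α * (CH * Real.exp (-(δ * (r₀ : ℝ))) * Real.exp (-(δ * cubeDist k vb vy))) := by
        rw [hu]; ring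
    _ ≤ (P.d : ℝ) * pd ^ α * (CM * Real.exp (-(δ * (r₀ : ℝ))) * Real.exp (-(δ * cubeDist k vb vy))) +
          pd ^ α * (CH * Real.exp (-(δ * (r₀ : ℝ))) * Real.exp (-(δ * cubeDist k vb vy))) :=
        add_le_add (mul_le_mul_of_nonneg_right
          (mul_le_mul_of_nonneg_left (hty.trans hpdα) (Nat.cast_nonneg _)) hK0) le_rfl
    _ = _ := by ring

/-- **Part 3 — the Hölder quotients of (1.32) for the two-variable field**: for same-direction product bonds `c, c′` of `□(v) × □(v′)` (admissible
cubes) at positive distance, `‖τ_{c,c′}(DF(c′)) − DF(c)‖ ≤ (C_H + dC_M)e^{−δr₀}e^{−δdist(□(v),□(v′))}·|z(c) − z(c′)|^α` (row pairs and column pairs alike,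
by the symmetry of the kernel). [cite: Balaban1983Higgs3, (2.5) p.424, (1.32) p.420] -/
theorem holder_part_leD (hS : ∀ μ, 2 < P.sitesPerDir 0 μ) (hkK : k ≤ P.K) {α δ CH CM : ℝ} (hα0 : 0 ≤ α) (hα1 : α ≤ 1) (hδ : 0 ≤ δ)
    (hCH : 0 ≤ CH) (hCM : 0 ≤ CM)
    (hH : ∀ (μ : Fin P.d) (x₁ x₂ x' : HiggsLattice.Site P 0) (Γ : List (HiggsLattice.Site P 0)),
      Interior k K₀ Ω₂ x₁ → Interior k K₀ Ω₂ x₂ → Interior k K₀ Ω₂ x' → x₁ ≠ x₂ → IsAdm x₁ x₂ Γ →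
      (P.mesh 0 ^ P.d)⁻¹ * ∑ i' : Ix N, ‖hol C A x₁ Γ (covDeriv C A (dG C Ω Ω₂ A msq a k (cb P N 0 (x', i'))) ⟨x₂, μ⟩)
          - covDeriv C A (dG C Ω Ω₂ A msq a k (cb P N 0 (x', i'))) ⟨x₁, μ⟩‖
        ≤ (P.mesh 0 * (HiggsLattice.Site.tdist x₁ x₂ : ℝ)) ^ α * (CH * (P.mesh k * (P.mesh k ^ P.d)⁻¹ * (P.mesh k ^ α)⁻¹)) *
          Real.exp (-(δ * (min (HiggsLattice.Site.tdist x₁ x' : ℝ) (HiggsLattice.Site.tdist x₂ x' : ℝ) / (P.L : ℝ) ^ k))) *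
          Real.exp (-(δ * (min (min (distC Ω₂ x₁) (distC Ω₂ x₂)) (distC Ω₂ x') / (P.L : ℝ) ^ k))))
    (hM : ∀ (μ ν : Fin P.d) (x x' : HiggsLattice.Site P 0), Interior k K₀ Ω₂ x → Interior k K₀ Ω₂ x' →
      (P.mesh 0 ^ P.d)⁻¹ * ((P.mesh 0)⁻¹ *
          ∑ i : Ix N, ‖covDeriv C A (dG C Ω Ω₂ A msq a k (dip C A ⟨x', ν⟩ (onb N i))) ⟨x, μ⟩‖)
        ≤ CM * (P.mesh k ^ P.d)⁻¹ * Real.exp (-(δ * ((HiggsLattice.Site.tdist x x' : ℝ) / (P.L : ℝ) ^ k))) *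
          Real.exp (-(δ * ((distC Ω₂ x + distC Ω₂ x') / (P.L : ℝ) ^ k))))
    {v v' : HiggsLattice.Site P k} (hv : ∀ x, blockIter k x = v → Interior k K₀ Ω₂ x ∧ (r₀ : ℝ) * (P.L : ℝ) ^ k ≤ distC Ω₂ x)
    (hv' : ∀ x, blockIter k x = v' → Interior k K₀ Ω₂ x ∧ (r₀ : ℝ) * (P.L : ℝ) ^ k ≤ distC Ω₂ x)
    {c c' : PBd P} (hc : c ∈ bonds k v v') (hc' : c' ∈ bonds k v v')
    (hdir : dirOf c = dirOf c') (hpos : 0 < pdist k (baseOf c) (baseOf c')) :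
    ‖transp C A c c' (derivFD C Ω Ω₂ A msq a k c') - derivFD C Ω Ω₂ A msq a k c‖
      ≤ (CH + P.d * CM) * Real.exp (-(δ * (r₀ : ℝ))) * Real.exp (-(δ * cubeDist k v v')) * pdist k (baseOf c) (baseOf c') ^ α := by
  obtain ⟨hcx₁, -, hcy₁, -, -⟩ := bonds_spec hc
  obtain ⟨hcx₂, -, hcy₂, -, -⟩ := bonds_spec hc'
  rcases c with ⟨μ, x₁, y₁⟩ | ⟨μ, y₁, x₁⟩ <;> rcases c' with ⟨μ', x₂, y₂⟩ | ⟨μ', y₂, x₂⟩ <;>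
    simp only [dirOf, Sum.elim_inl, Sum.elim_inr, Sum.inl.injEq, Sum.inr.injEq, reduceCtorEq] at hdir <;> subst hdir
  · -- a ROW pair: bonds over `□(v)`, other sites in `□(v′)`
    simp only [hb, cubeB, cubeY, Sum.elim_inl] at hcx₁ hcy₁ hcx₂ hcy₂
    exact holder_coreD hS hkK hα0 hα1 hδ hCH hCM hH hM hv hv' μ hcx₁ hcx₂ hcy₁ hcy₂ hpos
  · -- a COLUMN pair: bonds over `□(v′)`, other sites in `□(v)`
    simp only [hb, cubeB, cubeY, Sum.elim_inr] at hcx₁ hcy₁ hcx₂ hcy₂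
    change 0 < max (HiggsLattice.Site.tdist y₁ y₂ : ℝ) (HiggsLattice.Site.tdist x₁ x₂ : ℝ) / (P.L : ℝ) ^ k at hpos
    rw [max_comm] at hpos
    have h := holder_coreD hS hkK hα0 hα1 hδ hCH hCM hH hM hv' hv μ hcx₁ hcx₂ hcy₁ hcy₂ hpos
    rw [cubeDist_comm] at h
    change _ ≤ _ * (max (HiggsLattice.Site.tdist y₁ y₂ : ℝ) (HiggsLattice.Site.tdist x₁ x₂ : ℝ) / (P.L : ℝ) ^ k) ^ α
    rw [max_comm]
    exact h

/-- **`‖hδG_k(Ω,Ω₂,A)h′‖_{1,α} ≤ (C_V + C_D + C_H + dC_M)·e^{−δr₀}·e^{−δdist(□(v),□(v′))}`** for admissible cubes, given the four kernel entries at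
scale `k` at interior points (value, derivative, Hölder, mixed) with a common rate `δ`. [cite: Balaban1983Higgs3, (2.5) p.424] -/
theorem normHGHD_le (hS : ∀ μ, 2 < P.sitesPerDir 0 μ) (hkK : k ≤ P.K) {α δ CV CD CH CM : ℝ} (hα0 : 0 ≤ α) (hα1 : α ≤ 1)
    (hδ : 0 ≤ δ) (hCV : 0 ≤ CV) (hCD : 0 ≤ CD) (hCH : 0 ≤ CH) (hCM : 0 ≤ CM)
    (hV : ∀ (x x' : HiggsLattice.Site P 0), Interior k K₀ Ω₂ x → Interior k K₀ Ω₂ x' →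
      (P.mesh 0 ^ P.d)⁻¹ * ∑ i' : Ix N, ‖dG C Ω Ω₂ A msq a k (cb P N 0 (x', i')) x‖
        ≤ CV * (P.mesh k ^ 2 * (P.mesh k ^ P.d)⁻¹) * Real.exp (-(δ * ((HiggsLattice.Site.tdist x x' : ℝ) / (P.L : ℝ) ^ k))) *
          Real.exp (-(δ * ((distC Ω₂ x + distC Ω₂ x') / (P.L : ℝ) ^ k))))
    (hDv : ∀ (μ : Fin P.d) (x x' : HiggsLattice.Site P 0), Interior k K₀ Ω₂ x → Interior k K₀ Ω₂ x' →
      (P.mesh 0 ^ P.d)⁻¹ * ∑ i' : Ix N, ‖covDeriv C A (dG C Ω Ω₂ A msq a k (cb P N 0 (x', i'))) ⟨x, μ⟩‖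
        ≤ CD * (P.mesh k * (P.mesh k ^ P.d)⁻¹) * Real.exp (-(δ * ((HiggsLattice.Site.tdist x x' : ℝ) / (P.L : ℝ) ^ k))) *
          Real.exp (-(δ * ((distC Ω₂ x + distC Ω₂ x') / (P.L : ℝ) ^ k))))
    (hH : ∀ (μ : Fin P.d) (x₁ x₂ x' : HiggsLattice.Site P 0) (Γ : List (HiggsLattice.Site P 0)),
      Interior k K₀ Ω₂ x₁ → Interior k K₀ Ω₂ x₂ → Interior k K₀ Ω₂ x' → x₁ ≠ x₂ → IsAdm x₁ x₂ Γ →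
      (P.mesh 0 ^ P.d)⁻¹ * ∑ i' : Ix N, ‖hol C A x₁ Γ (covDeriv C A (dG C Ω Ω₂ A msq a k (cb P N 0 (x', i'))) ⟨x₂, μ⟩)
          - covDeriv C A (dG C Ω Ω₂ A msq a k (cb P N 0 (x', i'))) ⟨x₁, μ⟩‖
        ≤ (P.mesh 0 * (HiggsLattice.Site.tdist x₁ x₂ : ℝ)) ^ α * (CH * (P.mesh k * (P.mesh k ^ P.d)⁻¹ * (P.mesh k ^ α)⁻¹)) *
          Real.exp (-(δ * (min (HiggsLattice.Site.tdist x₁ x' : ℝ) (HiggsLattice.Site.tdist x₂ x' : ℝ) / (P.L : ℝ) ^ k))) *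
          Real.exp (-(δ * (min (min (distC Ω₂ x₁) (distC Ω₂ x₂)) (distC Ω₂ x') / (P.L : ℝ) ^ k))))
    (hM : ∀ (μ ν : Fin P.d) (x x' : HiggsLattice.Site P 0), Interior k K₀ Ω₂ x → Interior k K₀ Ω₂ x' →
      (P.mesh 0 ^ P.d)⁻¹ * ((P.mesh 0)⁻¹ *
          ∑ i : Ix N, ‖covDeriv C A (dG C Ω Ω₂ A msq a k (dip C A ⟨x', ν⟩ (onb N i))) ⟨x, μ⟩‖)
        ≤ CM * (P.mesh k ^ P.d)⁻¹ * Real.exp (-(δ * ((HiggsLattice.Site.tdist x x' : ℝ) / (P.L : ℝ) ^ k))) *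
          Real.exp (-(δ * ((distC Ω₂ x + distC Ω₂ x') / (P.L : ℝ) ^ k))))
    {v v' : HiggsLattice.Site P k} (hv : ∀ x, blockIter k x = v → Interior k K₀ Ω₂ x ∧ (r₀ : ℝ) * (P.L : ℝ) ^ k ≤ distC Ω₂ x)
    (hv' : ∀ x, blockIter k x = v' → Interior k K₀ Ω₂ x ∧ (r₀ : ℝ) * (P.L : ℝ) ^ k ≤ distC Ω₂ x) :
    normHGHD C Ω Ω₂ A msq a k α v v'
      ≤ (CV + CD + CH + P.d * CM) * Real.exp (-(δ * (r₀ : ℝ))) * Real.exp (-(δ * cubeDist k v v')) := by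
  have h₁ := supNorm_le (S := sites k v v') (f := kerFD C Ω Ω₂ A msq a k) (by positivity)
    fun z hz => sup_part_leD hkK hδ hCV hV hv hv' hz
  have h₂ := supNorm_le (S := bonds k v v') (f := derivFD C Ω Ω₂ A msq a k) (by positivity)
    fun c hc => deriv_part_leD hkK hδ hCD hDv hv hv' hc
  have h₃ := holderSeminorm_le (α := α) (adm := fun c c' : PBd P => dirOf c = dirOf c')
    (dist := fun c c' => pdist k (baseOf c) (baseOf c')) (τ := transp C A) (S := bonds k v v') (f := derivFD C Ω Ω₂ A msq a k)
    (C := (CH + P.d * CM) * Real.exp (-(δ * (r₀ : ℝ))) * Real.exp (-(δ * cubeDist k v v'))) (by positivity)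
    fun c hc c' hc' hadm hpos => holder_part_leD hS hkK hα0 hα1 hδ hCH hCM hH hM hv hv' hc hc' hadm hpos
  unfold normHGHD norm132
  refine (add_le_add (add_le_add h₁ h₂) h₃).trans (le_of_eq ?_)
  ring

end Parts

/-! ## §4 The assembly: the four kernel entries at scale `k` at interior points give (2.5) for the carrier, all cube pairs -/

section Assembly

variable {k K₀ r₀ : ℕ} {hL1 : 1 < P.L} {C : ChargeData N} {Ω Ω₂ : Finset (HiggsLattice.Site P 0)} {A : HiggsLattice.VecField P 0}
  {msq a : ℝ}

set_option maxHeartbeats 1600000 in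
/-- **Transfer**: the four kernel entries of `δG_k(Ω,Ω₂,A)` at scale `k` in the model's units at interior points of `Ω₂` — value, row derivative,
transported Hölder difference, mixed second derivative, with the rates `δ₁, …, δ₄` and the boundary factors — give **(2.5) for the carrier**
`sect2DeltaRegNested … r₀` with `δ₀ = min δᵢ` and `O(1) = C_V + C_D + C_H + dC_M`, for EVERY margin `r₀`, every volume with `K ≥ 1`, `L ≥ 2`.
[cite: Balaban1983Higgs3, (2.5) p.424, (1.32) p.420] -/
theorem ineq25_of_bounds (hL2 : 2 ≤ P.L) (hk1 : 1 ≤ k) (hkK : k ≤ P.K) {α δ₁ δ₂ δ₃ δ₄ CV CD CH CM : ℝ} (hα0 : 0 ≤ α) (hα1 : α ≤ 1)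
    (hδ₁ : 0 < δ₁) (hδ₂ : 0 < δ₂) (hδ₃ : 0 < δ₃) (hδ₄ : 0 < δ₄) (hCV : 0 ≤ CV) (hCD : 0 ≤ CD) (hCH : 0 ≤ CH) (hCM : 0 ≤ CM)
    (hV : ∀ (x x' : HiggsLattice.Site P 0), Interior k K₀ Ω₂ x → Interior k K₀ Ω₂ x' →
      (P.mesh 0 ^ P.d)⁻¹ * ∑ i' : Ix N, ‖dG C Ω Ω₂ A msq a k (cb P N 0 (x', i')) x‖
        ≤ CV * (P.mesh k ^ 2 * (P.mesh k ^ P.d)⁻¹) * Real.exp (-(δ₁ * ((HiggsLattice.Site.tdist x x' : ℝ) / (P.L : ℝ) ^ k))) *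
          Real.exp (-(δ₁ * ((distC Ω₂ x + distC Ω₂ x') / (P.L : ℝ) ^ k))))
    (hDv : ∀ (μ : Fin P.d) (x x' : HiggsLattice.Site P 0), Interior k K₀ Ω₂ x → Interior k K₀ Ω₂ x' →
      (P.mesh 0 ^ P.d)⁻¹ * ∑ i' : Ix N, ‖covDeriv C A (dG C Ω Ω₂ A msq a k (cb P N 0 (x', i'))) ⟨x, μ⟩‖
        ≤ CD * (P.mesh k * (P.mesh k ^ P.d)⁻¹) * Real.exp (-(δ₂ * ((HiggsLattice.Site.tdist x x' : ℝ) / (P.L : ℝ) ^ k))) *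
          Real.exp (-(δ₂ * ((distC Ω₂ x + distC Ω₂ x') / (P.L : ℝ) ^ k))))
    (hH : ∀ (μ : Fin P.d) (x₁ x₂ x' : HiggsLattice.Site P 0) (Γ : List (HiggsLattice.Site P 0)),
      Interior k K₀ Ω₂ x₁ → Interior k K₀ Ω₂ x₂ → Interior k K₀ Ω₂ x' → x₁ ≠ x₂ → IsAdm x₁ x₂ Γ →
      (P.mesh 0 ^ P.d)⁻¹ * ∑ i' : Ix N, ‖hol C A x₁ Γ (covDeriv C A (dG C Ω Ω₂ A msq a k (cb P N 0 (x', i'))) ⟨x₂, μ⟩)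
          - covDeriv C A (dG C Ω Ω₂ A msq a k (cb P N 0 (x', i'))) ⟨x₁, μ⟩‖
        ≤ (P.mesh 0 * (HiggsLattice.Site.tdist x₁ x₂ : ℝ)) ^ α * (CH * (P.mesh k * (P.mesh k ^ P.d)⁻¹ * (P.mesh k ^ α)⁻¹)) *
          Real.exp (-(δ₃ * (min (HiggsLattice.Site.tdist x₁ x' : ℝ) (HiggsLattice.Site.tdist x₂ x' : ℝ) / (P.L : ℝ) ^ k))) *
          Real.exp (-(δ₃ * (min (min (distC Ω₂ x₁) (distC Ω₂ x₂)) (distC Ω₂ x') / (P.L : ℝ) ^ k))))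
    (hM : ∀ (μ ν : Fin P.d) (x x' : HiggsLattice.Site P 0), Interior k K₀ Ω₂ x → Interior k K₀ Ω₂ x' →
      (P.mesh 0 ^ P.d)⁻¹ * ((P.mesh 0)⁻¹ *
          ∑ i : Ix N, ‖covDeriv C A (dG C Ω Ω₂ A msq a k (dip C A ⟨x', ν⟩ (onb N i))) ⟨x, μ⟩‖)
        ≤ CM * (P.mesh k ^ P.d)⁻¹ * Real.exp (-(δ₄ * ((HiggsLattice.Site.tdist x x' : ℝ) / (P.L : ℝ) ^ k))) *
          Real.exp (-(δ₄ * ((distC Ω₂ x + distC Ω₂ x') / (P.L : ℝ) ^ k)))) :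
    (sect2DeltaRegNested hL1 C Ω Ω₂ A msq a k K₀ r₀).Ineq25 α (min (min δ₁ δ₂) (min δ₃ δ₄)) (CV + CD + CH + P.d * CM) := by
  obtain ⟨δ, hδdef⟩ : ∃ δ : ℝ, δ = min (min δ₁ δ₂) (min δ₃ δ₄) := ⟨_, rfl⟩
  rw [← hδdef]
  have hδ : 0 < δ := by rw [hδdef]; exact lt_min (lt_min hδ₁ hδ₂) (lt_min hδ₃ hδ₄)
  have hle₁ : δ ≤ δ₁ := by rw [hδdef]; exact (min_le_left _ _).trans (min_le_left _ _)
  have hle₂ : δ ≤ δ₂ := by rw [hδdef]; exact (min_le_left _ _).trans (min_le_right _ _)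
  have hle₃ : δ ≤ δ₃ := by rw [hδdef]; exact (min_le_right _ _).trans (min_le_left _ _)
  have hle₄ : δ ≤ δ₄ := by rw [hδdef]; exact (min_le_right _ _).trans (min_le_right _ _)
  have hS : ∀ μ, 2 < P.sitesPerDir 0 μ := two_lt_sitesPerDir (hk1.trans hkK) hL2
  have hmk := P.mesh_pos k
  have hm0 := P.mesh_pos 0
  have hdC : ∀ x : HiggsLattice.Site P 0, 0 ≤ distC Ω₂ x := fun x => distC_nonneg _ _
  -- the four inputs with the common rate
  have hV' : ∀ (x x' : HiggsLattice.Site P 0), Interior k K₀ Ω₂ x → Interior k K₀ Ω₂ x' →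
      (P.mesh 0 ^ P.d)⁻¹ * ∑ i' : Ix N, ‖dG C Ω Ω₂ A msq a k (cb P N 0 (x', i')) x‖
        ≤ CV * (P.mesh k ^ 2 * (P.mesh k ^ P.d)⁻¹) * Real.exp (-(δ * ((HiggsLattice.Site.tdist x x' : ℝ) / (P.L : ℝ) ^ k))) *
          Real.exp (-(δ * ((distC Ω₂ x + distC Ω₂ x') / (P.L : ℝ) ^ k))) := by
    intro x x' hx hx'
    have := hdC x; have := hdC x'
    exact (hV x x' hx hx').trans (mul_le_mul (mul_le_mul_of_nonneg_left (exp_rate_mono hle₁ (by positivity)) (by positivity))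
      (exp_rate_mono hle₁ (by positivity)) (Real.exp_pos _).le (by positivity))
  have hDv' : ∀ (μ : Fin P.d) (x x' : HiggsLattice.Site P 0), Interior k K₀ Ω₂ x → Interior k K₀ Ω₂ x' →
      (P.mesh 0 ^ P.d)⁻¹ * ∑ i' : Ix N, ‖covDeriv C A (dG C Ω Ω₂ A msq a k (cb P N 0 (x', i'))) ⟨x, μ⟩‖
        ≤ CD * (P.mesh k * (P.mesh k ^ P.d)⁻¹) * Real.exp (-(δ * ((HiggsLattice.Site.tdist x x' : ℝ) / (P.L : ℝ) ^ k))) *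
          Real.exp (-(δ * ((distC Ω₂ x + distC Ω₂ x') / (P.L : ℝ) ^ k))) := by
    intro μ x x' hx hx'
    have := hdC x; have := hdC x'
    exact (hDv μ x x' hx hx').trans (mul_le_mul (mul_le_mul_of_nonneg_left (exp_rate_mono hle₂ (by positivity)) (by positivity))
      (exp_rate_mono hle₂ (by positivity)) (Real.exp_pos _).le (by positivity))
  have hH' : ∀ (μ : Fin P.d) (x₁ x₂ x' : HiggsLattice.Site P 0) (Γ : List (HiggsLattice.Site P 0)),
      Interior k K₀ Ω₂ x₁ → Interior k K₀ Ω₂ x₂ → Interior k K₀ Ω₂ x' → x₁ ≠ x₂ → IsAdm x₁ x₂ Γ →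
      (P.mesh 0 ^ P.d)⁻¹ * ∑ i' : Ix N, ‖hol C A x₁ Γ (covDeriv C A (dG C Ω Ω₂ A msq a k (cb P N 0 (x', i'))) ⟨x₂, μ⟩)
          - covDeriv C A (dG C Ω Ω₂ A msq a k (cb P N 0 (x', i'))) ⟨x₁, μ⟩‖
        ≤ (P.mesh 0 * (HiggsLattice.Site.tdist x₁ x₂ : ℝ)) ^ α * (CH * (P.mesh k * (P.mesh k ^ P.d)⁻¹ * (P.mesh k ^ α)⁻¹)) *
          Real.exp (-(δ * (min (HiggsLattice.Site.tdist x₁ x' : ℝ) (HiggsLattice.Site.tdist x₂ x' : ℝ) / (P.L : ℝ) ^ k))) *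
          Real.exp (-(δ * (min (min (distC Ω₂ x₁) (distC Ω₂ x₂)) (distC Ω₂ x') / (P.L : ℝ) ^ k))) := by
    intro μ x₁ x₂ x' Γ hx₁ hx₂ hx' hne hΓ
    have := hdC x₁; have := hdC x₂; have := hdC x'
    have h0 : 0 ≤ (P.mesh 0 * (HiggsLattice.Site.tdist x₁ x₂ : ℝ)) ^ α * (CH * (P.mesh k * (P.mesh k ^ P.d)⁻¹ * (P.mesh k ^ α)⁻¹)) := by
      have : 0 ≤ (P.mesh 0 * (HiggsLattice.Site.tdist x₁ x₂ : ℝ)) ^ α := Real.rpow_nonneg (by positivity) _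
      have : 0 < P.mesh k ^ α := Real.rpow_pos_of_pos hmk α
      positivity
    have hmin1 : 0 ≤ min (HiggsLattice.Site.tdist x₁ x' : ℝ) (HiggsLattice.Site.tdist x₂ x' : ℝ) / (P.L : ℝ) ^ k :=
      div_nonneg (le_min (Nat.cast_nonneg _) (Nat.cast_nonneg _)) (by positivity)
    have hmin2 : 0 ≤ min (min (distC Ω₂ x₁) (distC Ω₂ x₂)) (distC Ω₂ x') / (P.L : ℝ) ^ k :=
      div_nonneg (le_min (le_min (hdC _) (hdC _)) (hdC _)) (by positivity)
    exact (hH μ x₁ x₂ x' Γ hx₁ hx₂ hx' hne hΓ).trans (mul_le_mul (mul_le_mul_of_nonneg_left (exp_rate_mono hle₃ hmin1) h0)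
      (exp_rate_mono hle₃ hmin2) (Real.exp_pos _).le (by positivity))
  have hM' : ∀ (μ ν : Fin P.d) (x x' : HiggsLattice.Site P 0), Interior k K₀ Ω₂ x → Interior k K₀ Ω₂ x' →
      (P.mesh 0 ^ P.d)⁻¹ * ((P.mesh 0)⁻¹ *
          ∑ i : Ix N, ‖covDeriv C A (dG C Ω Ω₂ A msq a k (dip C A ⟨x', ν⟩ (onb N i))) ⟨x, μ⟩‖)
        ≤ CM * (P.mesh k ^ P.d)⁻¹ * Real.exp (-(δ * ((HiggsLattice.Site.tdist x x' : ℝ) / (P.L : ℝ) ^ k))) *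
          Real.exp (-(δ * ((distC Ω₂ x + distC Ω₂ x') / (P.L : ℝ) ^ k))) := by
    intro μ ν x x' hx hx'
    have := hdC x; have := hdC x'
    exact (hM μ ν x x' hx hx').trans (mul_le_mul (mul_le_mul_of_nonneg_left (exp_rate_mono hle₄ (by positivity)) (by positivity))
      (exp_rate_mono hle₄ (by positivity)) (Real.exp_pos _).le (by positivity))
  rw [ineq25_iff]
  refine ⟨fun v v' => normHGHD_le hS hkK hα0 hα1 hδ.le hCV hCD hCH hCM hV' hDv' hH' hM' v.2 v'.2, fun n n' v v' => ?_⟩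
  positivity

end Assembly

/-! ## §5 The Hölder and mixed kernel entries of `δG_k(Ω,Ω₂,A)` AT SCALE `k`: summing the pieces `j < k` (as r14's value/derivative sums)

At interior points of `Ω₂` every margin exceeds `2L^kK₀(d+1) ≥ 4L^kK₀` (r14's `le_distC_of_interior`), so half of the boundary factor of the
`j`-th piece is `≤ e^{−2δK₀L^{k−j}}`; this doubly-exponential decay pays for the ratio `(L^jε)^{e}/(L^kε)^{e} ≤ (L^{k−j})^{d}` of the piece
scales (any real exponent `e ≥ −d`), and the scale sum is r14's `piece_sum_le`. -/

section ScaleSums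

variable {k : ℕ}

/-- **One piece against the top scale, any exponent `e ≥ −d`**: `(L^jε)^e ≤ (L^kε)^e·(L^{k−j})^d` for `j ≤ k`. [folklore] -/
private theorem rpow_piece_le_top {j : ℕ} (hjk : j ≤ k) {e : ℝ} (he : -(P.d : ℝ) ≤ e) :
    P.mesh j ^ e ≤ P.mesh k ^ e * ((P.L : ℝ) ^ (k - j)) ^ P.d := by
  have hmj : 0 < P.mesh j := P.mesh_pos j
  have hL1 : (1 : ℝ) ≤ P.L := by exact_mod_cast P.hL
  set Λ : ℝ := (P.L : ℝ) ^ (k - j) with hΛ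
  have hΛ1 : 1 ≤ Λ := one_le_pow₀ hL1
  have hΛ0 : 0 < Λ := lt_of_lt_of_le one_pos hΛ1
  have hmkj : P.mesh k = Λ * P.mesh j := by
    rw [hΛ, mesh_eq_pow_mul P k, mesh_eq_pow_mul P j, ← mul_assoc, ← pow_add, Nat.sub_add_cancel hjk]
  rw [hmkj, Real.mul_rpow hΛ0.le hmj.le, ← Real.rpow_natCast Λ P.d]
  have h1 : (1 : ℝ) ≤ Λ ^ e * Λ ^ (P.d : ℝ) := by
    rw [← Real.rpow_add hΛ0]
    exact Real.one_le_rpow hΛ1 (by linarith)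
  have h0 : 0 ≤ P.mesh j ^ e := Real.rpow_nonneg hmj.le _
  calc P.mesh j ^ e = 1 * P.mesh j ^ e := (one_mul _).symm
    _ ≤ (Λ ^ e * Λ ^ (P.d : ℝ)) * P.mesh j ^ e := mul_le_mul_of_nonneg_right h1 h0
    _ = _ := by ring

/-- the inverse volume of a piece against the top scale: `(L^jε)^{−d} = (L^{k−j})^d·(L^kε)^{−d}`. [folklore] -/
private theorem inv_pow_piece_eq_top {j : ℕ} (hjk : j ≤ k) :
    (P.mesh j ^ P.d)⁻¹ = ((P.L : ℝ) ^ (k - j)) ^ P.d * (P.mesh k ^ P.d)⁻¹ := by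
  have hmj : 0 < P.mesh j := P.mesh_pos j
  have hmkj : P.mesh k = (P.L : ℝ) ^ (k - j) * P.mesh j := by
    rw [mesh_eq_pow_mul P k, mesh_eq_pow_mul P j, ← mul_assoc, ← pow_add, Nat.sub_add_cancel hjk]
  rw [hmkj, mul_pow, mul_inv]
  have hΛ : ((P.L : ℝ) ^ (k - j)) ^ P.d ≠ 0 := pow_ne_zero _ (pow_ne_zero _ (by have := P.hL; positivity))
  field_simp

/-- the distance factor of a piece is below the top-scale one: `e^{−δS/L^j} ≤ e^{−δS/L^k}` (`j ≤ k`, `S ≥ 0`). [folklore] -/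
private theorem exp_S_le_top {j : ℕ} (hjk : j ≤ k) {δ S : ℝ} (hδ : 0 ≤ δ) (hS : 0 ≤ S) :
    Real.exp (-(δ * (S / (P.L : ℝ) ^ j))) ≤ Real.exp (-(δ * (S / (P.L : ℝ) ^ k))) := by
  have hL1 : (1 : ℝ) ≤ P.L := by exact_mod_cast P.hL
  have hLj : (0 : ℝ) < (P.L : ℝ) ^ j := pow_pos (by positivity) j
  exact exp_dist_mono hδ (div_le_div_of_nonneg_left hS hLj (pow_le_pow_right₀ hL1 hjk))

/-- **the boundary factor of a low piece at an interior margin**: for `j < k` and `R ≥ 4L^kK₀`,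
`e^{−δR/L^j} ≤ e^{−(δ/2)R/L^k}·e^{−2δK₀L^{k−j}}`. [cite: Balaban1983Higgs3, (2.5)–(2.6) p.424] -/
theorem exp_R_le_top {j K₀ : ℕ} (hjk : j < k) {δ R : ℝ} (hδ : 0 ≤ δ) (hR0 : 0 ≤ R) (hR : 4 * ((P.L : ℝ) ^ k * K₀) ≤ R) :
    Real.exp (-(δ * (R / (P.L : ℝ) ^ j)))
      ≤ Real.exp (-(δ / 2 * (R / (P.L : ℝ) ^ k))) * Real.exp (-(2 * δ * K₀ * (P.L : ℝ) ^ (k - j))) := by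
  have hL1 : (1 : ℝ) ≤ P.L := by exact_mod_cast P.hL
  have hLj : (0 : ℝ) < (P.L : ℝ) ^ j := pow_pos (by positivity) j
  have hLk : (0 : ℝ) < (P.L : ℝ) ^ k := pow_pos (by positivity) k
  rw [← Real.exp_add]
  apply Real.exp_le_exp.mpr
  have hA : R / (P.L : ℝ) ^ k ≤ R / (P.L : ℝ) ^ j := div_le_div_of_nonneg_left hR0 hLj (pow_le_pow_right₀ hL1 hjk.le)
  have hkj : (P.L : ℝ) ^ k = (P.L : ℝ) ^ (k - j) * (P.L : ℝ) ^ j := by rw [← pow_add, Nat.sub_add_cancel hjk.le]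
  have hB : 4 * K₀ * (P.L : ℝ) ^ (k - j) ≤ R / (P.L : ℝ) ^ j := by
    rw [le_div_iff₀ hLj]
    calc 4 * K₀ * (P.L : ℝ) ^ (k - j) * (P.L : ℝ) ^ j = 4 * ((P.L : ℝ) ^ k * K₀) := by rw [hkj]; ring
      _ ≤ R := hR
  nlinarith

variable {K₀ : ℕ} {C : ChargeData N} {Ω Ω₂ : Finset (HiggsLattice.Site P 0)} {A : HiggsLattice.VecField P 0} {msq a : ℝ}

/-- kernel: `(L^jε)^{−1}·(ε·m) = m/L^j` (the carrier currency of r14's statements against this file's). [folklore] -/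
private theorem scale_inv_mul (j : ℕ) (m : ℝ) : (P.mesh j)⁻¹ * (P.mesh 0 * m) = m / (P.L : ℝ) ^ j := by
  rw [mesh_eq_pow_mul P j, mul_inv, mul_assoc, ← mul_assoc (P.mesh 0)⁻¹, inv_mul_cancel₀ (P.mesh_pos 0).ne', one_mul,
    div_eq_inv_mul]

/-- kernel: `δ·(L^jε)^{−1}·(ε·m) = δ·(m/L^j)`. [folklore] -/
private theorem scale_inv_mul' (j : ℕ) (δ m : ℝ) : δ * (P.mesh j)⁻¹ * (P.mesh 0 * m) = δ * (m / (P.L : ℝ) ^ j) := by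
  rw [mul_assoc, scale_inv_mul]

/-- kernel: `(L^jη)^{1−d−α} = (L^jη)·((L^jη)^d)^{−1}·((L^jη)^α)^{−1}`. [folklore] -/
private theorem rpow_one_sub_sub (j : ℕ) (α : ℝ) :
    P.mesh j ^ ((1 : ℝ) - (P.d : ℝ) - α) = P.mesh j * (P.mesh j ^ P.d)⁻¹ * (P.mesh j ^ α)⁻¹ := by
  have hs := P.mesh_pos j
  rw [Real.rpow_sub hs, Real.rpow_sub hs, Real.rpow_one, Real.rpow_natCast _ P.d, div_eq_mul_inv, div_eq_mul_inv]

/-- The transported Hölder term of `δG_k = Σ_{j<k} δpiece_j` is below the sum of the pieces' terms (`hol`, `D^ε_A` linear).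
[cite: Balaban1983Higgs3, (2.6) p.424] -/
theorem holderTop_le_sum (hm : 0 < msq) (ha : 0 < a) (hL1 : 1 < P.L) (hk : 1 ≤ k) (hkK : k ≤ P.K) (μ : Fin P.d)
    (x₁ x₂ x' : HiggsLattice.Site P 0) (Γ : List (HiggsLattice.Site P 0)) :
    (P.mesh 0 ^ P.d)⁻¹ * ∑ i' : Ix N, ‖hol C A x₁ Γ (covDeriv C A (dG C Ω Ω₂ A msq a k (cb P N 0 (x', i'))) ⟨x₂, μ⟩)
        - covDeriv C A (dG C Ω Ω₂ A msq a k (cb P N 0 (x', i'))) ⟨x₁, μ⟩‖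
      ≤ ∑ j ∈ Finset.range k, dHolderTerm C Ω Ω₂ A msq a k j μ x₁ x₂ x' Γ := by
  have hsum := (sum_dPiece (C := C) (Ω := Ω) (Ω₂ := Ω₂) (A := A) hm ha hL1 hk hkK).symm
  have hterm : ∀ i' : Ix N, ‖hol C A x₁ Γ (covDeriv C A (dG C Ω Ω₂ A msq a k (cb P N 0 (x', i'))) ⟨x₂, μ⟩)
        - covDeriv C A (dG C Ω Ω₂ A msq a k (cb P N 0 (x', i'))) ⟨x₁, μ⟩‖
      ≤ ∑ j ∈ Finset.range k, ‖hol C A x₁ Γ (covDeriv C A (dPiece C Ω Ω₂ A msq a k j (cb P N 0 (x', i'))) ⟨x₂, μ⟩)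
          - covDeriv C A (dPiece C Ω Ω₂ A msq a k j (cb P N 0 (x', i'))) ⟨x₁, μ⟩‖ := by
    intro i'
    rw [hsum, LinearMap.sum_apply, B3Ineq210RegularTorus.covDeriv_sum'', B3Ineq210RegularTorus.covDeriv_sum'', map_sum,
      ← Finset.sum_sub_distrib]
    exact norm_sum_le _ _
  unfold dHolderTerm
  rw [← Finset.mul_sum, Finset.sum_comm]
  exact mul_le_mul_of_nonneg_left (Finset.sum_le_sum fun i' _ => hterm i') (inv_nonneg.mpr (pow_nonneg (P.mesh_pos 0).le _))

/-- The mixed term of `δG_k` is below the sum of p33 g58's per-piece mixed terms (`δpiece_j = G^η_{(j)}(Ω) − G^η_{(j)}(Ω₂)`).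
[cite: Balaban1983Higgs3, (2.6) p.424] -/
theorem mixedTop_le_sum (hm : 0 < msq) (ha : 0 < a) (hL1 : 1 < P.L) (hk : 1 ≤ k) (hkK : k ≤ P.K) (μ ν : Fin P.d)
    (x x' : HiggsLattice.Site P 0) :
    (P.mesh 0 ^ P.d)⁻¹ * ((P.mesh 0)⁻¹ *
        ∑ i : Ix N, ‖covDeriv C A (dG C Ω Ω₂ A msq a k (dip C A ⟨x', ν⟩ (onb N i))) ⟨x, μ⟩‖)
      ≤ ∑ j ∈ Finset.range k, mixedDeltaTermR C Ω Ω₂ A msq a k j μ ν x x' := by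
  have hsum := (sum_dPiece (C := C) (Ω := Ω) (Ω₂ := Ω₂) (A := A) hm ha hL1 hk hkK).symm
  have hterm : ∀ i : Ix N, ‖covDeriv C A (dG C Ω Ω₂ A msq a k (dip C A ⟨x', ν⟩ (onb N i))) ⟨x, μ⟩‖
      ≤ ∑ j ∈ Finset.range k, ‖covDeriv C A (dPiece C Ω Ω₂ A msq a k j (dip C A ⟨x', ν⟩ (onb N i))) ⟨x, μ⟩‖ := by
    intro i
    rw [hsum, LinearMap.sum_apply, B3Ineq210RegularTorus.covDeriv_sum'']
    exact norm_sum_le _ _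
  have h0 : 0 ≤ (P.mesh 0 ^ P.d)⁻¹ * (P.mesh 0)⁻¹ := by have := P.mesh_pos 0; positivity
  calc (P.mesh 0 ^ P.d)⁻¹ * ((P.mesh 0)⁻¹ *
        ∑ i : Ix N, ‖covDeriv C A (dG C Ω Ω₂ A msq a k (dip C A ⟨x', ν⟩ (onb N i))) ⟨x, μ⟩‖)
      = ((P.mesh 0 ^ P.d)⁻¹ * (P.mesh 0)⁻¹) *
        ∑ i : Ix N, ‖covDeriv C A (dG C Ω Ω₂ A msq a k (dip C A ⟨x', ν⟩ (onb N i))) ⟨x, μ⟩‖ := by ring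
    _ ≤ ((P.mesh 0 ^ P.d)⁻¹ * (P.mesh 0)⁻¹) * ∑ i : Ix N, ∑ j ∈ Finset.range k,
        ‖covDeriv C A (dPiece C Ω Ω₂ A msq a k j (dip C A ⟨x', ν⟩ (onb N i))) ⟨x, μ⟩‖ :=
        mul_le_mul_of_nonneg_left (Finset.sum_le_sum fun i _ => hterm i) h0
    _ = ∑ j ∈ Finset.range k, mixedDeltaTermR C Ω Ω₂ A msq a k j μ ν x x' := by
        rw [Finset.sum_comm, Finset.mul_sum]
        refine Finset.sum_congr rfl fun j _ => ?_
        unfold mixedDeltaTermR dPiece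
        ring

set_option maxHeartbeats 1600000 in
/-- **THE HÖLDER ENTRY OF THE KERNEL OF `δG_k(Ω,Ω₂,A)` AT SCALE `k`, AT A REGULAR NON-CONSTANT BACKGROUND, NESTED BIG-BLOCK REGIONS** — the
scale sum of `B3DeltaGkHolderRegularNested.dPiece_holder_bound_explicit`: for `d ≥ 1`, `L ≥ 2`, `a, m² > 0`, `c ≥ 0`, `N`: `∃E₀ ∀C (e² ≤ E₀)
∃K₀min ∀ 0 ≤ α < 1 ∀K₀ ≥ K₀min ∃ t δ₁ C > 0` such that for every volume (`d`, `L`, `K₀ ∣ M`), every `1 ≤ k ≤ K` with `L^kε ≤ 1`, `3L^kK₀ ≤ |T_ε|_μ`,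
every nested pair of big-block unions `Ω₂ ⊆ Ω`, every `A` `δ_A`-regular on `Ω` with `L^kδ_A|e| ≤ t`, `L^kδ_A ≤ c|e|`, every `μ`, all INTERIOR `x₁ ≠ x₂`,
`x′` of `Ω₂` and every admissible contour `Γ`:
`ε^{−d}Σ_{i′}‖U(A(Γ))(D^ε_{A,μ}δG_k e_{(x′,i′)})(x₂) − (D^ε_{A,μ}δG_k e_{(x′,i′)})(x₁)‖ ≤ (ε|x₁−x₂|)^α·C(L^kε)^{1−d−α}·e^{−δ₁min(|x₁−x′|,|x₂−x′|)/L^k}·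
e^{−δ₁min(dist(x₁,Ω₂ᶜ),dist(x₂,Ω₂ᶜ),dist(x′,Ω₂ᶜ))/L^k}`, UNIFORMLY IN `k` — in the `η`-units of p. 414 the transported Hölder quotient of the kernel
of `δG_k(Ω,Ω₂,B̃)` at exponent `α`, the third summand of (1.32). [cite: Balaban1983Higgs3, (1.16) p.414, (1.32) p.420, (2.5)–(2.6) p.424, (2.11) p.426]
[cite: Balaban1982Higgs1, Prop. 2.1 (2.24)–(2.26) p.610, Prop. 2.3 pp.611–612] -/
theorem dG_holder_bound_explicit (d L : ℕ) (hd : 1 ≤ d) (hL : 2 ≤ L) {a : ℝ} (ha : 0 < a) {msq : ℝ} (hmsq : 0 < msq)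
    {c : ℝ} (hc : 0 ≤ c) (N : ℕ) :
    ∃ E₀ : ℝ, 0 < E₀ ∧ ∀ (C : ChargeData N), C.e ^ 2 ≤ E₀ →
      ∃ K₀min : ℕ, ∀ {α : ℝ}, 0 ≤ α → α < 1 → ∀ K₀ : ℕ, K₀min ≤ K₀ → ∃ t δ₁ Cst : ℝ, 0 < t ∧ 0 < δ₁ ∧ 0 < Cst ∧
      ∀ (P : HiggsLattice.Params), 1 < P.L → P.d = d → P.L = L → K₀ ∣ P.M →
      ∀ {k : ℕ}, 1 ≤ k → k ≤ P.K → (∀ μ, 3 * half P k K₀ ≤ P.sitesPerDir 0 μ) → P.mesh k ≤ 1 →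
      ∀ (Ω Ω₂ : Finset (HiggsLattice.Site P 0)), IsBigBlockUnion k K₀ Ω → IsBigBlockUnion k K₀ Ω₂ → Ω₂ ⊆ Ω →
      ∀ (A : HiggsLattice.VecField P 0) {δA : ℝ}, 0 ≤ δA →
        (∀ z ∈ Ω, ∀ μ ν : Fin P.d, |A ⟨z.shift ν, μ⟩ - A ⟨z, μ⟩| ≤ δA) →
        (P.L : ℝ) ^ k * δA * |C.e| ≤ t → (P.L : ℝ) ^ k * δA ≤ c * |C.e| →
        ∀ (μ : Fin P.d) (x₁ x₂ x' : HiggsLattice.Site P 0) (Γ : List (HiggsLattice.Site P 0)),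
          Interior k K₀ Ω₂ x₁ → Interior k K₀ Ω₂ x₂ → Interior k K₀ Ω₂ x' → x₁ ≠ x₂ → IsAdm x₁ x₂ Γ →
          (P.mesh 0 ^ P.d)⁻¹ * ∑ i' : Ix N, ‖hol C A x₁ Γ (covDeriv C A (dG C Ω Ω₂ A msq a k (cb P N 0 (x', i'))) ⟨x₂, μ⟩)
              - covDeriv C A (dG C Ω Ω₂ A msq a k (cb P N 0 (x', i'))) ⟨x₁, μ⟩‖
            ≤ (P.mesh 0 * (HiggsLattice.Site.tdist x₁ x₂ : ℝ)) ^ α * (Cst * (P.mesh k * (P.mesh k ^ P.d)⁻¹ * (P.mesh k ^ α)⁻¹)) *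
              Real.exp (-(δ₁ * (min (HiggsLattice.Site.tdist x₁ x' : ℝ) (HiggsLattice.Site.tdist x₂ x' : ℝ) / (P.L : ℝ) ^ k))) *
              Real.exp (-(δ₁ * (min (min (distC Ω₂ x₁) (distC Ω₂ x₂)) (distC Ω₂ x') / (P.L : ℝ) ^ k))) := by
  obtain ⟨E₀, hE₀, hP⟩ := dPiece_holder_bound_explicit d L hd hL ha hmsq hc N
  refine ⟨E₀, hE₀, fun C heE => ?_⟩
  obtain ⟨K₀min, hK⟩ := hP C heE
  refine ⟨max K₀min 1, fun {α} hα0 hα1 K₀ hK₀ => ?_⟩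
  have hK₀1 : 1 ≤ K₀ := (le_max_right _ _).trans hK₀
  obtain ⟨t, δ₁, Cst, ht, hδ₁, hCst, hmain⟩ := hK hα0 hα1 K₀ ((le_max_left _ _).trans hK₀)
  have hc2 : 0 < 2 * δ₁ * (K₀ : ℝ) := by positivity
  refine ⟨t, δ₁ / 2, Cst * (((d + 1).factorial : ℝ) / (2 * δ₁ * K₀) ^ (d + 1)), ht, by positivity, by positivity, ?_⟩
  intro P hP1 hPd hPL hK₀M k hk1 hkK h3 hmesh Ω Ω₂ hΩ hΩ₂ hsub A δA hδA hreg htA hcA μ x₁ x₂ x' Γ hx₁ hx₂ hx' hne hΓ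
  have hmain' := hmain P hP1 hPd hPL hK₀M hk1 hkK h3 hmesh Ω Ω₂ hΩ hΩ₂ hsub A hδA hreg htA hcA
  subst hPd hPL
  have hm0 : 0 < P.mesh 0 := P.mesh_pos 0
  have hmk : 0 < P.mesh k := P.mesh_pos k
  set W : ℝ := (P.mesh 0 * (HiggsLattice.Site.tdist x₁ x₂ : ℝ)) ^ α with hW
  have hW0 : 0 ≤ W := Real.rpow_nonneg (by positivity) _
  set S : ℝ := min (HiggsLattice.Site.tdist x₁ x' : ℝ) (HiggsLattice.Site.tdist x₂ x' : ℝ) with hSdef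
  set R : ℝ := min (min (distC Ω₂ x₁) (distC Ω₂ x₂)) (distC Ω₂ x') with hRdef
  have hS0 : 0 ≤ S := le_min (Nat.cast_nonneg _) (Nat.cast_nonneg _)
  have hR0 : 0 ≤ R := le_min (le_min (distC_nonneg _ _) (distC_nonneg _ _)) (distC_nonneg _ _)
  have hu0 : 0 < P.mesh k * (P.mesh k ^ P.d)⁻¹ * (P.mesh k ^ α)⁻¹ := by
    have : 0 < P.mesh k ^ α := Real.rpow_pos_of_pos hmk α
    positivity
  have hRHS : 0 ≤ W * (Cst * (((P.d + 1).factorial : ℝ) / (2 * δ₁ * K₀) ^ (P.d + 1)) *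
      (P.mesh k * (P.mesh k ^ P.d)⁻¹ * (P.mesh k ^ α)⁻¹)) * Real.exp (-(δ₁ / 2 * (S / (P.L : ℝ) ^ k))) *
      Real.exp (-(δ₁ / 2 * (R / (P.L : ℝ) ^ k))) := by positivity
  -- the case `Ω₂ = T_ε`: then `Ω = T_ε` and `δG_k = 0`
  by_cases huniv : Ω₂ = Finset.univ
  · have hΩu : Ω = Finset.univ := Finset.eq_univ_of_forall fun z => hsub (huniv ▸ Finset.mem_univ z)
    have h0 : dG C Ω Ω₂ A msq a k = 0 := by rw [dG, hΩu, huniv, sub_self]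
    simp only [h0, LinearMap.zero_apply, covDeriv_zero'', map_zero, sub_zero, norm_zero, Finset.sum_const_zero, mul_zero]
    exact hRHS
  obtain ⟨z₀, hz₀⟩ : ∃ z₀, z₀ ∉ Ω₂ := not_forall.mp fun h => huniv (Finset.eq_univ_of_forall h)
  have hR4 : 4 * ((P.L : ℝ) ^ k * K₀) ≤ R := by
    have h1 := le_distC_of_interior hz₀ hx₁
    have h2 := le_distC_of_interior hz₀ hx₂
    have h3 := le_distC_of_interior hz₀ hx'
    have hd1 : (2 : ℝ) ≤ (P.d : ℝ) + 1 := by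
      have : (1 : ℝ) ≤ (P.d : ℝ) := by exact_mod_cast hd
      linarith
    have h0 : 0 ≤ (P.L : ℝ) ^ k * K₀ := by positivity
    have h4 : 4 * ((P.L : ℝ) ^ k * K₀) ≤ 2 * ((P.L : ℝ) ^ k * K₀) * (P.d + 1) := by nlinarith
    exact h4.trans (le_min (le_min h1 h2) h3)
  -- termwise bounds against the top scale
  have hF : ∀ j, j < k → dHolderTerm C Ω Ω₂ A msq a k j μ x₁ x₂ x' Γ
      ≤ (W * (Cst * (P.mesh k * (P.mesh k ^ P.d)⁻¹ * (P.mesh k ^ α)⁻¹)) * Real.exp (-(δ₁ / 2 * (S / (P.L : ℝ) ^ k))) *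
          Real.exp (-(δ₁ / 2 * (R / (P.L : ℝ) ^ k)))) *
        (((P.L : ℝ) ^ (k - j)) ^ P.d * Real.exp (-(2 * δ₁ * K₀ * (P.L : ℝ) ^ (k - j)))) := by
    intro j hj
    refine (hmain' j μ x₁ x₂ x' hx₁ hx₂ hx' hne Γ hΓ).trans ?_
    rw [scale_inv_mul', scale_inv_mul']
    have he : -(P.d : ℝ) ≤ (1 : ℝ) - (P.d : ℝ) - α := by linarith
    have h1 := rpow_piece_le_top (P := P) hj.le he
    rw [rpow_one_sub_sub k α] at h1
    have h2 : Real.exp (-(δ₁ * (S / (P.L : ℝ) ^ j))) ≤ Real.exp (-(δ₁ / 2 * (S / (P.L : ℝ) ^ k))) :=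
      (exp_S_le_top hj.le hδ₁.le hS0).trans (exp_rate_mono (by linarith) (by positivity))
    have h3 := exp_R_le_top (P := P) (K₀ := K₀) hj hδ₁.le hR0 hR4
    have hA0 : 0 ≤ W * (Cst * P.mesh j ^ ((1 : ℝ) - (P.d : ℝ) - α)) := by
      have := Real.rpow_nonneg (P.mesh_pos j).le ((1 : ℝ) - (P.d : ℝ) - α)
      positivity
    calc W * (Cst * P.mesh j ^ ((1 : ℝ) - (P.d : ℝ) - α)) * Real.exp (-(δ₁ * (S / (P.L : ℝ) ^ j))) *
          Real.exp (-(δ₁ * (R / (P.L : ℝ) ^ j)))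
        ≤ W * (Cst * (P.mesh k * (P.mesh k ^ P.d)⁻¹ * (P.mesh k ^ α)⁻¹ * ((P.L : ℝ) ^ (k - j)) ^ P.d)) *
          Real.exp (-(δ₁ / 2 * (S / (P.L : ℝ) ^ k))) *
          (Real.exp (-(δ₁ / 2 * (R / (P.L : ℝ) ^ k))) * Real.exp (-(2 * δ₁ * K₀ * (P.L : ℝ) ^ (k - j)))) := by
          refine mul_le_mul (mul_le_mul (mul_le_mul_of_nonneg_left (mul_le_mul_of_nonneg_left h1 hCst.le) hW0) h2
            (Real.exp_pos _).le ?_) h3 (Real.exp_pos _).le ?_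
          · positivity
          · positivity
      _ = _ := by ring
  have hB : 0 ≤ W * (Cst * (P.mesh k * (P.mesh k ^ P.d)⁻¹ * (P.mesh k ^ α)⁻¹)) * Real.exp (-(δ₁ / 2 * (S / (P.L : ℝ) ^ k))) *
      Real.exp (-(δ₁ / 2 * (R / (P.L : ℝ) ^ k))) := by positivity
  have htot := piece_sum_le P.L hL hc2 (fun j => dHolderTerm C Ω Ω₂ A msq a k j μ x₁ x₂ x' Γ) hB hF
  calc (P.mesh 0 ^ P.d)⁻¹ * ∑ i' : Ix N, ‖hol C A x₁ Γ (covDeriv C A (dG C Ω Ω₂ A msq a k (cb P N 0 (x', i'))) ⟨x₂, μ⟩)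
          - covDeriv C A (dG C Ω Ω₂ A msq a k (cb P N 0 (x', i'))) ⟨x₁, μ⟩‖
      ≤ ∑ j ∈ Finset.range k, dHolderTerm C Ω Ω₂ A msq a k j μ x₁ x₂ x' Γ := holderTop_le_sum hmsq ha hP1 hk1 hkK μ x₁ x₂ x' Γ
    _ ≤ _ := htot
    _ = _ := by ring

set_option maxHeartbeats 1600000 in
/-- **THE MIXED (TWICE-DIFFERENTIATED) ENTRY OF THE KERNEL OF `δG_k(Ω,Ω₂,A)` AT SCALE `k`** — the scale sum of p33 g58's
`B3DeltaGkMixedRegularRegion.deltaGk_mixed_regularRegion`: same data; for all INTERIOR `x, x′` of `Ω₂` and all directions `μ, ν`: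
`ε^{−d}ε^{−1}Σ_i‖(D^ε_{A,μ}δG_k dip_{⟨x′,ν⟩}e_i)(x)‖ ≤ C(L^kε)^{−d}·e^{−δ₁|x−x′|/L^k}·e^{−δ₁(dist(x,Ω₂ᶜ)+dist(x′,Ω₂ᶜ))/L^k}`, UNIFORMLY IN `k` (one
covariant derivative in each variable, «for each differentiation an additional factor (L^jη)^{−1}»).
[cite: Balaban1983Higgs3, (1.16) p.414, (2.5)–(2.6) p.424, (2.10) p.426] [cite: Balaban1982Higgs1, Prop. 2.1 (2.25)–(2.26) p.610, Prop. 2.3 pp.611–612] -/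
theorem dG_mixed_bound_explicit (d L : ℕ) (hd : 1 ≤ d) (hL : 2 ≤ L) {a : ℝ} (ha : 0 < a) {msq : ℝ} (hmsq : 0 < msq)
    {c : ℝ} (hc : 0 ≤ c) (N : ℕ) :
    ∃ E₀ : ℝ, 0 < E₀ ∧ ∀ (C : ChargeData N), C.e ^ 2 ≤ E₀ →
      ∃ K₀min : ℕ, ∀ K₀ : ℕ, K₀min ≤ K₀ → ∃ t δ₁ Cst : ℝ, 0 < t ∧ 0 < δ₁ ∧ 0 < Cst ∧
      ∀ (P : HiggsLattice.Params), 1 < P.L → P.d = d → P.L = L → K₀ ∣ P.M →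
      ∀ {k : ℕ}, 1 ≤ k → k ≤ P.K → (∀ μ, 3 * half P k K₀ ≤ P.sitesPerDir 0 μ) → P.mesh k ≤ 1 →
      ∀ (Ω Ω₂ : Finset (HiggsLattice.Site P 0)), IsBigBlockUnion k K₀ Ω → IsBigBlockUnion k K₀ Ω₂ → Ω₂ ⊆ Ω →
      ∀ (A : HiggsLattice.VecField P 0) {δA : ℝ}, 0 ≤ δA →
        (∀ z ∈ Ω, ∀ μ ν : Fin P.d, |A ⟨z.shift ν, μ⟩ - A ⟨z, μ⟩| ≤ δA) →
        (P.L : ℝ) ^ k * δA * |C.e| ≤ t → (P.L : ℝ) ^ k * δA ≤ c * |C.e| →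
        ∀ (μ ν : Fin P.d) (x x' : HiggsLattice.Site P 0), Interior k K₀ Ω₂ x → Interior k K₀ Ω₂ x' →
          (P.mesh 0 ^ P.d)⁻¹ * ((P.mesh 0)⁻¹ *
              ∑ i : Ix N, ‖covDeriv C A (dG C Ω Ω₂ A msq a k (dip C A ⟨x', ν⟩ (onb N i))) ⟨x, μ⟩‖)
            ≤ Cst * (P.mesh k ^ P.d)⁻¹ * Real.exp (-(δ₁ * ((HiggsLattice.Site.tdist x x' : ℝ) / (P.L : ℝ) ^ k))) *
              Real.exp (-(δ₁ * ((distC Ω₂ x + distC Ω₂ x') / (P.L : ℝ) ^ k))) := by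
  obtain ⟨E₀, hE₀, hP⟩ := deltaGk_mixed_regularRegion d L hd hL ha hmsq N hc
  refine ⟨E₀, hE₀, fun C heE => ?_⟩
  obtain ⟨K₀min, hK⟩ := hP C heE
  refine ⟨max K₀min 1, fun K₀ hK₀ => ?_⟩
  have hK₀1 : 1 ≤ K₀ := (le_max_right _ _).trans hK₀
  obtain ⟨t, δ₁, Cst, ht, hδ₁, hCst, hmain⟩ := hK K₀ ((le_max_left _ _).trans hK₀)
  have hc2 : 0 < 2 * δ₁ * (K₀ : ℝ) := by positivity
  refine ⟨t, δ₁ / 2, Cst * (((d + 1).factorial : ℝ) / (2 * δ₁ * K₀) ^ (d + 1)), ht, by positivity, by positivity, ?_⟩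
  intro P hP1 hPd hPL hK₀M k hk1 hkK h3 hmesh Ω Ω₂ hΩ hΩ₂ hsub A δA hδA hreg htA hcA μ ν x x' hx hx'
  have hmain' := hmain P hPd hPL hK₀M hk1 hkK h3 hmesh Ω Ω₂ hΩ hΩ₂ hsub A hδA hreg htA hcA
  subst hPd hPL
  have hm0 : 0 < P.mesh 0 := P.mesh_pos 0
  have hmk : 0 < P.mesh k := P.mesh_pos k
  set S : ℝ := (HiggsLattice.Site.tdist x x' : ℝ) with hSdef
  set R : ℝ := distC Ω₂ x + distC Ω₂ x' with hRdef
  have hS0 : 0 ≤ S := Nat.cast_nonneg _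
  have hR0 : 0 ≤ R := add_nonneg (distC_nonneg _ _) (distC_nonneg _ _)
  have hRHS : 0 ≤ Cst * (((P.d + 1).factorial : ℝ) / (2 * δ₁ * K₀) ^ (P.d + 1)) * (P.mesh k ^ P.d)⁻¹ *
      Real.exp (-(δ₁ / 2 * (S / (P.L : ℝ) ^ k))) * Real.exp (-(δ₁ / 2 * (R / (P.L : ℝ) ^ k))) := by positivity
  by_cases huniv : Ω₂ = Finset.univ
  · have hΩu : Ω = Finset.univ := Finset.eq_univ_of_forall fun z => hsub (huniv ▸ Finset.mem_univ z)
    have h0 : dG C Ω Ω₂ A msq a k = 0 := by rw [dG, hΩu, huniv, sub_self]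
    simp only [h0, LinearMap.zero_apply, covDeriv_zero'', norm_zero, Finset.sum_const_zero, mul_zero]
    exact hRHS
  obtain ⟨z₀, hz₀⟩ : ∃ z₀, z₀ ∉ Ω₂ := not_forall.mp fun h => huniv (Finset.eq_univ_of_forall h)
  have hR4 : 4 * ((P.L : ℝ) ^ k * K₀) ≤ R := by
    have h1 := le_distC_of_interior hz₀ hx
    have h2 := le_distC_of_interior hz₀ hx'
    have hd1 : (1 : ℝ) ≤ (P.d : ℝ) + 1 := by linarith [(Nat.cast_nonneg P.d : (0 : ℝ) ≤ P.d)]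
    have h0 : 0 ≤ (P.L : ℝ) ^ k * K₀ := by positivity
    nlinarith
  have hF : ∀ j, j < k → mixedDeltaTermR C Ω Ω₂ A msq a k j μ ν x x'
      ≤ (Cst * (P.mesh k ^ P.d)⁻¹ * Real.exp (-(δ₁ / 2 * (S / (P.L : ℝ) ^ k))) * Real.exp (-(δ₁ / 2 * (R / (P.L : ℝ) ^ k)))) *
        (((P.L : ℝ) ^ (k - j)) ^ P.d * Real.exp (-(2 * δ₁ * K₀ * (P.L : ℝ) ^ (k - j)))) := by
    intro j hj
    refine (hmain' j μ ν x x' hx hx').trans ?_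
    have hsplit : Real.exp (-(δ₁ * ((S + distC Ω₂ x + distC Ω₂ x') / (P.L : ℝ) ^ j)))
        = Real.exp (-(δ₁ * (S / (P.L : ℝ) ^ j))) * Real.exp (-(δ₁ * (R / (P.L : ℝ) ^ j))) := by
      rw [← Real.exp_add, hRdef]; congr 1; rw [add_assoc, add_div]; ring
    rw [hsplit, inv_pow_piece_eq_top hj.le]
    have h2 : Real.exp (-(δ₁ * (S / (P.L : ℝ) ^ j))) ≤ Real.exp (-(δ₁ / 2 * (S / (P.L : ℝ) ^ k))) :=
      (exp_S_le_top hj.le hδ₁.le hS0).trans (exp_rate_mono (by linarith) (by positivity))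
    have h3 := exp_R_le_top (P := P) (K₀ := K₀) hj hδ₁.le hR0 hR4
    calc Cst * (((P.L : ℝ) ^ (k - j)) ^ P.d * (P.mesh k ^ P.d)⁻¹) * (Real.exp (-(δ₁ * (S / (P.L : ℝ) ^ j))) *
          Real.exp (-(δ₁ * (R / (P.L : ℝ) ^ j))))
        ≤ Cst * (((P.L : ℝ) ^ (k - j)) ^ P.d * (P.mesh k ^ P.d)⁻¹) * (Real.exp (-(δ₁ / 2 * (S / (P.L : ℝ) ^ k))) *
          (Real.exp (-(δ₁ / 2 * (R / (P.L : ℝ) ^ k))) * Real.exp (-(2 * δ₁ * K₀ * (P.L : ℝ) ^ (k - j))))) :=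
          mul_le_mul_of_nonneg_left (mul_le_mul h2 h3 (Real.exp_pos _).le (Real.exp_pos _).le) (by positivity)
      _ = _ := by ring
  have hB : 0 ≤ Cst * (P.mesh k ^ P.d)⁻¹ * Real.exp (-(δ₁ / 2 * (S / (P.L : ℝ) ^ k))) * Real.exp (-(δ₁ / 2 * (R / (P.L : ℝ) ^ k))) := by
    positivity
  have htot := piece_sum_le P.L hL hc2 (fun j => mixedDeltaTermR C Ω Ω₂ A msq a k j μ ν x x') hB hF
  calc (P.mesh 0 ^ P.d)⁻¹ * ((P.mesh 0)⁻¹ *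
        ∑ i : Ix N, ‖covDeriv C A (dG C Ω Ω₂ A msq a k (dip C A ⟨x', ν⟩ (onb N i))) ⟨x, μ⟩‖)
      ≤ ∑ j ∈ Finset.range k, mixedDeltaTermR C Ω Ω₂ A msq a k j μ ν x x' := mixedTop_le_sum hmsq ha hP1 hk1 hkK μ ν x x'
    _ ≤ _ := htot
    _ = _ := by rw [hSdef, hRdef]; ring

end ScaleSums

/-! ## §6 (2.5) for `δG_k(Ω,Ω₂,A)` at a regular background on nested big-block regions — the hypothesis-free plug

The four kernel entries of `δG_k(Ω,Ω₂,A)` at scale `k` — r14's value and row-derivative sums (`B3DeltaGkKernelRegularNested`), the Hölder and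
mixed sums of §5 — fed into `ineq25_of_bounds`: smallness `E₀ = min`, `K₀min = max`, `t = min` of the four, rate `δ₀ = min δᵢ`, constant
`C_V + C_D + C_H + dC_M`. -/

section Plug

/-- kernel: `(L^kε)^{2−d} = (L^kε)²·((L^kε)^d)^{−1}`. [folklore] -/
private theorem rpow_two_sub (P : HiggsLattice.Params) (k : ℕ) :
    P.mesh k ^ ((2 : ℝ) - (P.d : ℝ)) = P.mesh k ^ 2 * (P.mesh k ^ P.d)⁻¹ := by
  rw [Real.rpow_sub (P.mesh_pos k), Real.rpow_two, Real.rpow_natCast, div_eq_mul_inv]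

/-- kernel: `(L^kε)^{1−d} = (L^kε)·((L^kε)^d)^{−1}`. [folklore] -/
private theorem rpow_one_sub (P : HiggsLattice.Params) (k : ℕ) :
    P.mesh k ^ ((1 : ℝ) - (P.d : ℝ)) = P.mesh k * (P.mesh k ^ P.d)⁻¹ := by
  rw [Real.rpow_sub (P.mesh_pos k), Real.rpow_one, Real.rpow_natCast, div_eq_mul_inv]

set_option maxHeartbeats 1600000 in
/-- **INEQUALITY (2.5) OF [B3] FOR `δG_k(Ω,Ω₂,B̃)` AT A REGULAR NON-CONSTANT BACKGROUND `B̃ = A`, NESTED BIG-BLOCK REGIONS `Ω₂ ⊆ Ω ⊂ T_ε`,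
PROVED FOR THE CARRIER `sect2DeltaRegNested` OF THE DECL OF RECORD `ScaledKernels.Ineq25`.**  For `d ≥ 1`, `L ≥ 2`, `a, m² > 0`, `c ≥ 0`, `N`:
`∃E₀ > 0 ∀C (e² ≤ E₀) ∃K₀min ∀ 0 ≤ α < 1 ∀K₀ ≥ K₀min ∃ t, δ₀, C > 0` such that for every volume (`d`, `L`, `K₀ ∣ M`), every `1 ≤ k ≤ K` with
`L^kε ≤ 1` and three big blocks a side (`3L^kK₀ ≤ |T_ε|_μ`), every nested pair of unions of big blocks `Ω₂ ⊆ Ω`, every `A` that is `δ_A`-regular ON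
`Ω` ((I.2.23)) with `L^kδ_A|e| ≤ t` and `L^kδ_A ≤ c|e|`, and every margin `r₀`:
`(sect2DeltaRegNested _ C Ω Ω₂ A m² a k K₀ r₀).Ineq25 α δ₀ C`, i.e. `‖□(v)δG_k(Ω,Ω₂,A)□(v′)‖_{1,α} ≤ C·e^{−δ₀r₀}·e^{−δ₀dist(□(v),□(v′))}` in the
(1.32) reading of p40's (3.1) files for ALL pairs of unit cubes of interior points of `Ω₂` at lattice distance `≥ r₀L^k` from `Ω₂ᶜ` (and the
(1.16) clause trivially — not modelled).  Inputs BY NAME: r14's `dG_kernel_bound_explicit`/`dG_kernel_deriv_bound_explicit` (p345219), §5's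
`dG_holder_bound_explicit` (over p33 g60's `dPiece_holder_bound_explicit`, p345432) and `dG_mixed_bound_explicit` (over p33 g58's
`deltaGk_mixed_regularRegion`, p344322), and §4's `ineq25_of_bounds`.  Honest scope: module docstring (F7).
[cite: Balaban1983Higgs3, (2.5)–(2.6) p.424, (1.16) p.414, (1.32) p.420, (2.10)–(2.12) p.426]
[cite: Balaban1982Higgs1, Prop. 2.1 (2.24)–(2.26) p.610, Prop. 2.3 (2.34)–(2.38) pp.611–612] -/
theorem ineq25_regularNested (d L : ℕ) (hd : 1 ≤ d) (hL : 2 ≤ L) {a : ℝ} (ha : 0 < a) {msq : ℝ} (hmsq : 0 < msq)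
    {c : ℝ} (hc : 0 ≤ c) (N : ℕ) :
    ∃ E₀ : ℝ, 0 < E₀ ∧ ∀ (C : ChargeData N), C.e ^ 2 ≤ E₀ →
      ∃ K₀min : ℕ, ∀ {α : ℝ}, 0 ≤ α → α < 1 → ∀ K₀ : ℕ, K₀min ≤ K₀ → ∃ t δ₀ Cst : ℝ, 0 < t ∧ 0 < δ₀ ∧ 0 < Cst ∧
      ∀ (P : HiggsLattice.Params) (hP1 : 1 < P.L), P.d = d → P.L = L → K₀ ∣ P.M →
      ∀ {k : ℕ}, 1 ≤ k → k ≤ P.K → (∀ μ, 3 * half P k K₀ ≤ P.sitesPerDir 0 μ) → P.mesh k ≤ 1 →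
      ∀ (Ω Ω₂ : Finset (HiggsLattice.Site P 0)), IsBigBlockUnion k K₀ Ω → IsBigBlockUnion k K₀ Ω₂ → Ω₂ ⊆ Ω →
      ∀ (A : HiggsLattice.VecField P 0) {δA : ℝ}, 0 ≤ δA →
        (∀ z ∈ Ω, ∀ μ ν : Fin P.d, |A ⟨z.shift ν, μ⟩ - A ⟨z, μ⟩| ≤ δA) →
        (P.L : ℝ) ^ k * δA * |C.e| ≤ t → (P.L : ℝ) ^ k * δA ≤ c * |C.e| →
        ∀ r₀ : ℕ, (sect2DeltaRegNested hP1 C Ω Ω₂ A msq a k K₀ r₀).Ineq25 α δ₀ Cst := by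
  obtain ⟨E₁, hE₁, h1⟩ := dG_kernel_bound_explicit d L hd hL ha hmsq hc N
  obtain ⟨E₂, hE₂, h2⟩ := dG_kernel_deriv_bound_explicit d L hd hL ha hmsq hc N
  obtain ⟨E₃, hE₃, h3⟩ := dG_holder_bound_explicit d L hd hL ha hmsq hc N
  obtain ⟨E₄, hE₄, h4⟩ := dG_mixed_bound_explicit d L hd hL ha hmsq hc N
  refine ⟨min (min E₁ E₂) (min E₃ E₄), lt_min (lt_min hE₁ hE₂) (lt_min hE₃ hE₄), fun C heE => ?_⟩
  have he1 : C.e ^ 2 ≤ E₁ := heE.trans ((min_le_left _ _).trans (min_le_left _ _))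
  have he2 : C.e ^ 2 ≤ E₂ := heE.trans ((min_le_left _ _).trans (min_le_right _ _))
  have he3 : C.e ^ 2 ≤ E₃ := heE.trans ((min_le_right _ _).trans (min_le_left _ _))
  have he4 : C.e ^ 2 ≤ E₄ := heE.trans ((min_le_right _ _).trans (min_le_right _ _))
  obtain ⟨K₁, hK₁⟩ := h1 C he1
  obtain ⟨K₂, hK₂⟩ := h2 C he2
  obtain ⟨K₃, hK₃⟩ := h3 C he3
  obtain ⟨K₄, hK₄⟩ := h4 C he4
  refine ⟨max (max K₁ K₂) (max K₃ K₄), fun {α} hα0 hα1 K₀ hK₀ => ?_⟩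
  obtain ⟨t₁, δ₁, C₁, ht₁, hδ₁, hC₁, hm1⟩ := hK₁ K₀ ((le_max_left K₁ K₂).trans ((le_max_left _ _).trans hK₀))
  obtain ⟨t₂, δ₂, C₂, ht₂, hδ₂, hC₂, hm2⟩ := hK₂ K₀ ((le_max_right K₁ K₂).trans ((le_max_left _ _).trans hK₀))
  obtain ⟨t₃, δ₃, C₃, ht₃, hδ₃, hC₃, hm3⟩ := hK₃ hα0 hα1 K₀ ((le_max_left K₃ K₄).trans ((le_max_right _ _).trans hK₀))
  obtain ⟨t₄, δ₄, C₄, ht₄, hδ₄, hC₄, hm4⟩ := hK₄ K₀ ((le_max_right K₃ K₄).trans ((le_max_right _ _).trans hK₀))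
  refine ⟨min (min t₁ t₂) (min t₃ t₄), min (min δ₁ δ₂) (min δ₃ δ₄), C₁ + C₂ + C₃ + d * C₄,
    lt_min (lt_min ht₁ ht₂) (lt_min ht₃ ht₄), lt_min (lt_min hδ₁ hδ₂) (lt_min hδ₃ hδ₄), by positivity, ?_⟩
  intro P hP1 hPd hPL hK₀M k hk1 hkK h3h hmesh Ω Ω₂ hΩ hΩ₂ hsub A δA hδA hreg htA hcA r₀
  have ht1 : (P.L : ℝ) ^ k * δA * |C.e| ≤ t₁ := htA.trans ((min_le_left _ _).trans (min_le_left _ _))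
  have ht2 : (P.L : ℝ) ^ k * δA * |C.e| ≤ t₂ := htA.trans ((min_le_left _ _).trans (min_le_right _ _))
  have ht3 : (P.L : ℝ) ^ k * δA * |C.e| ≤ t₃ := htA.trans ((min_le_right _ _).trans (min_le_left _ _))
  have ht4 : (P.L : ℝ) ^ k * δA * |C.e| ≤ t₄ := htA.trans ((min_le_right _ _).trans (min_le_right _ _))
  have hV := hm1 P hP1 hPd hPL hK₀M hk1 hkK h3h hmesh Ω Ω₂ hΩ hΩ₂ hsub A hδA hreg ht1 hcA
  have hDv := hm2 P hP1 hPd hPL hK₀M hk1 hkK h3h hmesh Ω Ω₂ hΩ hΩ₂ hsub A hδA hreg ht2 hcA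
  have hH := hm3 P hP1 hPd hPL hK₀M hk1 hkK h3h hmesh Ω Ω₂ hΩ hΩ₂ hsub A hδA hreg ht3 hcA
  have hM := hm4 P hP1 hPd hPL hK₀M hk1 hkK h3h hmesh Ω Ω₂ hΩ hΩ₂ hsub A hδA hreg ht4 hcA
  subst hPd hPL
  refine ineq25_of_bounds hL hk1 hkK hα0 hα1.le hδ₁ hδ₂ hδ₃ hδ₄ hC₁.le hC₂.le hC₃.le hC₄.le ?_ ?_ hH hM
  · intro x x' hx hx'
    have h := hV x x' hx hx'
    rw [scale_inv_mul', scale_inv_mul', rpow_two_sub] at h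
    exact h
  · intro μ x x' hx hx'
    have h := hDv μ x x' hx hx'
    rw [scale_inv_mul', scale_inv_mul', rpow_one_sub] at h
    exact h

/-- **Corollary (the printed shape, first conjunct)**: under the data of `ineq25_regularNested`, for every pair of admissible cubes
`‖□(v)δG_k(Ω,Ω₂,A)□(v′)‖_{1,α} ≤ C·e^{−δ₀r₀}·e^{−δ₀dist(□(v),□(v′))}` — (2.5) with `dist(Ω₂,∂Ω)` read as the margin `r₀` of the localizations.
[cite: Balaban1983Higgs3, (2.5) p.424, (1.32) p.420] -/
theorem normHGHD_le_of_ineq25 {P : HiggsLattice.Params} {N : ℕ} {hL1 : 1 < P.L} {C : ChargeData N}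
    {Ω Ω₂ : Finset (HiggsLattice.Site P 0)} {A : HiggsLattice.VecField P 0} {msq a : ℝ} {k K₀ r₀ : ℕ} {α δ₀ Cst : ℝ}
    (h : (sect2DeltaRegNested hL1 C Ω Ω₂ A msq a k K₀ r₀).Ineq25 α δ₀ Cst) (v v' : LocCube k K₀ Ω₂ r₀) :
    normHGHD C Ω Ω₂ A msq a k α v.1 v'.1 ≤ Cst * Real.exp (-(δ₀ * (r₀ : ℝ))) * Real.exp (-(δ₀ * cubeDist k v.1 v'.1)) :=
  ((ineq25_iff α δ₀ Cst).mp h).1 v v'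

end Plug

end Literature.MathematicalPhysics.QuantumFieldTheory.Balaban1983to89.B3Ineq25RegularNested
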